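import Literature.Topology.FourManifolds.BandSumSymmetry
import Literature.Topology.FourManifolds.BandSumWindowFamily
import Literature.Topology.FourManifolds.KnotFamilyAmbientIsotopy
import Literature.Topology.FourManifolds.BandSumDisjointRange
import HarnessLib

/-!
# Band sums with the same regular band: the ambient isotopy (lifted-arc assembly)

Fact seat `provefact-Literature.Topology.FourManifolds.BandData.isIsotopic_of_band_eq`; sibling proof
file of `BandSumIsotopyRegular.lean`. It **proves** the corrected geometric heart
`BandData.exists_ambientIsotopy_of_band_eq_of_isRegular` and the corrected printed theorem
`BandData.isIsotopic_of_band_eq_of_isRegular` of that file outright: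

* `BandData.exists_ambientIsotopy_of_band_eq_of_isRegular_holds`,
* `BandData.isIsotopic_of_band_eq_of_isRegular_holds`
  (through the landed reduction `isIsotopic_of_band_eq_of_isRegular_of`),

by the **lifted-arc construction** (§ "Discharge by the lifted-arc construction" below): the two
arc windows of `K` are moved onto those of `K'` through embedded *space* arcs in the thickened band
(`BandSumWindowFamily.lean`, `LiftedArcFamily.lean`, `BandSumArcMatching.lean`), and the resulting
smooth family of modifications of `K` is covered by an ambient isotopy stationary off `V`
(`KnotFamilyAmbientIsotopy.lean`, `IsotopyExtensionRel.lean`); the disjointness of the summands is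
the proved `Knot.IsBandSum.disjoint_range_holds` (`BandSumDisjointRange.lean`). This completes the
programme of `BandSumIsotopyRegular.lean`, § "Plan of the proof" ((N2) `BandThickening.lean`,
(N3) `BandTransport.lean`, junction analysis `BandSumJunction.lean`, `BandSumJunctionCoords.lean`,
`BandSumSymmetry.lean`), with the 2-dimensional step of that plan replaced by the lift through the
third dimension.

**History (review of a decomposition, D-0026).** The first version of this file assembled the
heart from a 2-dimensional *named fact* (two proper arcs in a half-disc, flat at their common
endpoints, are ambient isotopic rel boundary with controlled support) by transporting a planar
diffeotopy of the parameter plane along the thickened band. That statement is true but of the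
strength of the smooth Schoenflies theorem in the plane (Hirsch (1976), Ch. 8 §3, Thm. 3.1 treats
discs with free boundary only), far beyond the present needs, and the lifted-arc proof made it
unnecessary; the named fact, its two-arc planar diffeotopy and the conditional assembly have been
removed. The transport lemmas written for it (§§ "Moved sets", "Transport infrastructure") are
proved and kept.

## Contents

* § generic: `Diffeotopy.movedSet` (points moved by some stage; stages preserve it and fix its
  complement, `image_eq_of_disjoint_movedSet`, `movedSet_trans_subset`), `Diffeotopy.conjBy`
  (conjugation by a diffeomorphism, stages `e ∘ F_t ∘ e⁻¹` — the tree's `Diffeotopy.conj` of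
  `SurgeredMappingTorus.lean` is the other convention and lives behind a heavy import chain;
  `conjBy_toFun`, `movedSet_conjBy`), `Diffeomorph.ofInvolutive`,
  `Knot.exists_nhds_inter_range_subset` (near a point of an open arc of a knot, the knot is that
  arc), `PatchThickening.transport_apply_emb_eq_self`, `PatchThickening.copy`.
* § halves: `lowerHalf`/`upperHalf` (the open halves of the collar square), the half-turn
  `halfTurnDiffeo` and the images of arcs, balls and halves under it.
* § transport infrastructure (for a planar diffeotopy `h` of the parameter plane whose moved set
  lies in a compact `C` and in the two open halves): fixing lemma `BandData.fixesOff_range`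
  (`FixesOff`): **points of `K` off the band surface lie over parameters never moved by `h`, below
  a uniform height** — by compactness of `range K` from the pointwise statements off the
  thickening, at nonzero height, over parameters outside the closure of the moved set, on the open
  arcs (`Knot.exists_nhds_inter_range_subset`), and at the four attaching points
  (`fixesOff_nhds_corner`, `eq_corner_of_mem_closure`, from the corner controls (C1) of
  `BandSumJunctionCoords.lean` / `BandSumSymmetry.lean`: off-band points of `K` near an attaching
  point project outside the closed strip `{-δ ≤ x₁ ≤ 1 + δ} ⊇ closure movedSet`);
  `BandData.exists_tube_subset`: the stationarity tube (generalised tube lemma);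
  `BandData.sameOrientationAt_of_fix`: the orientation clause at `p`, from junction analysis I for
  `b` and `b'` and the agreement of `F₁ ∘ K` with `K` just before `p` (the last two are used by the
  lifted-arc assembly as well).
* § lifted-arc assembly: `twoWindowFam`, `BandData.exists_ambientIsotopy_of_isRegular_lift`, and
  the two discharges above.

## References

* R. E. Gompf, A. I. Stipsicz, *4-Manifolds and Kirby Calculus* (1999), §5.1 (band sums along a
  given band). [GompfStipsicz1999]
* P. R. Cromwell, *Knots and Links* (2004), §4.6 (the product of oriented knots along a rectangle
  is well defined). [Cromwell2004]
* M. W. Hirsch, *Differential Topology* (1976), Ch. 8 §1 Thm. 1.3 (isotopy extension).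
  [HirschDT1976]

## Design notes

* No named fact is stated in this file; everything here is proved. Local notation `𝔼 n`, `𝕊 n`
  follows the directory pattern. Nothing here uses `sorry`.
-/


open scoped Manifold ContDiff Topology Real RealInnerProductSpace
open Function Set Metric Filter

noncomputable section

namespace Literature.Topology.FourManifolds

/-- Local notation: `𝔼 n` is the model Euclidean space `EuclideanSpace ℝ (Fin n)`. -/
local notation "𝔼 " n:arg => EuclideanSpace ℝ (Fin n)

/-- Local notation: `𝕊 n` is the unit sphere in `EuclideanSpace ℝ (Fin (n + 1))`. -/
local notation "𝕊 " n:arg => (Metric.sphere (0 : EuclideanSpace ℝ (Fin (n + 1))) 1)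

/-! ## Moved sets, conjugation of diffeotopies -/

namespace Diffeotopy

variable {EN HN : Type*} [NormedAddCommGroup EN] [NormedSpace ℝ EN] [TopologicalSpace HN]
  {J : ModelWithCorners ℝ EN HN} {N : Type*} [TopologicalSpace N] [ChartedSpace HN N]

/-- The **moved set** of a diffeotopy: the points moved by some stage. [folklore] -/
def movedSet (D : Diffeotopy J N) : Set N := {x | ∃ t, D.toFun t x ≠ x}

/-- Points off the moved set are fixed by every stage. [folklore] -/
theorem toFun_eq_self_of_not_mem_movedSet (D : Diffeotopy J N) {x : N} (hx : x ∉ D.movedSet) (t : ℝ) :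
    D.toFun t x = x := by
  by_contra h
  exact hx ⟨t, h⟩

/-- A moved point lies in the moved set. [folklore] -/
theorem mem_movedSet_of_toFun_ne (D : Diffeotopy J N) {x : N} {t : ℝ} (h : D.toFun t x ≠ x) :
    x ∈ D.movedSet := ⟨t, h⟩

/-- Every stage maps the moved set into itself (a stage is injective and fixes the complement).
[folklore] -/
theorem toFun_mem_movedSet (D : Diffeotopy J N) {x : N} (hx : x ∈ D.movedSet) (t : ℝ) :
    D.toFun t x ∈ D.movedSet := by
  by_contra h
  have h1 : D.toFun t (D.toFun t x) = D.toFun t x := D.toFun_eq_self_of_not_mem_movedSet h t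
  have h2 : D.toFun t x = x := (D.stage t).injective h1
  obtain ⟨s, hs⟩ := hx
  rw [h2] at h
  exact h ⟨s, hs⟩

/-- A set disjoint from the moved set is mapped onto itself by every stage. [folklore] -/
theorem image_eq_of_disjoint_movedSet (D : Diffeotopy J N) {S : Set N} (hS : Disjoint S D.movedSet)
    (t : ℝ) : D.toFun t '' S = S := by
  have hfix : ∀ x ∈ S, D.toFun t x = x := fun x hx ↦
    D.toFun_eq_self_of_not_mem_movedSet (Set.disjoint_left.1 hS hx) t
  ext y
  constructor
  · rintro ⟨x, hx, rfl⟩; rwa [hfix x hx]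
  · intro hy; exact ⟨y, hy, hfix y hy⟩

/-- Images under a stage of a union with a set off the moved set. [folklore] -/
theorem image_union_of_disjoint_movedSet (D : Diffeotopy J N) {S S' : Set N}
    (hS' : Disjoint S' D.movedSet) (t : ℝ) : D.toFun t '' (S ∪ S') = D.toFun t '' S ∪ S' := by
  rw [image_union, D.image_eq_of_disjoint_movedSet hS']

/-- The moved set of a stagewise composition. [folklore] -/
theorem movedSet_trans_subset (D D' : Diffeotopy J N) : (D.trans D').movedSet ⊆ D.movedSet ∪ D'.movedSet := by
  rintro x ⟨t, ht⟩
  by_contra h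
  simp only [mem_union, not_or] at h
  apply ht
  rw [trans_toFun, comp_apply, D.toFun_eq_self_of_not_mem_movedSet h.1,
    D'.toFun_eq_self_of_not_mem_movedSet h.2]

/-- **Conjugation** of a diffeotopy by a diffeomorphism: stages `e ∘ F_t ∘ e⁻¹` (conjugate the
track by `id × e`). (The tree's `Diffeotopy.conj`, `SurgeredMappingTorus.lean`, is the convention
`e⁻¹ ∘ F_t ∘ e`; that file's import chain is avoided here.) [folklore] -/
def conjBy (D : Diffeotopy J N) (e : N ≃ₘ⟮J, J⟯ N) : Diffeotopy J N where
  track := (((Diffeomorph.refl 𝓘(ℝ, ℝ) ℝ ∞).prodCongr e).symm.trans D.track).trans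
    ((Diffeomorph.refl 𝓘(ℝ, ℝ) ℝ ∞).prodCongr e)
  track_fst p := by
    obtain ⟨t, x⟩ := p
    simp [Diffeomorph.prodCongr_symm, D.track_apply]
  track_zero x := by
    simp [Diffeomorph.prodCongr_symm, D.track_apply]

/-- Stages of the conjugate. [folklore] -/
@[simp]
theorem conjBy_toFun (D : Diffeotopy J N) (e : N ≃ₘ⟮J, J⟯ N) (t : ℝ) :
    (D.conjBy e).toFun t = e ∘ D.toFun t ∘ e.symm := by
  funext x
  show (((Diffeomorph.refl 𝓘(ℝ, ℝ) ℝ ∞).prodCongr e)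
    (D.track (((Diffeomorph.refl 𝓘(ℝ, ℝ) ℝ ∞).prodCongr e).symm (t, x)))).2 = e (D.toFun t (e.symm x))
  rw [Diffeomorph.prodCongr_symm, Diffeomorph.coe_prodCongr, Diffeomorph.coe_prodCongr, Prod.map_apply,
    D.track_apply]
  rfl

/-- The moved set of the conjugate is the image of the moved set. [folklore] -/
theorem movedSet_conjBy (D : Diffeotopy J N) (e : N ≃ₘ⟮J, J⟯ N) : (D.conjBy e).movedSet = e '' D.movedSet := by
  ext y
  simp only [movedSet, mem_setOf_eq, conjBy_toFun, comp_apply, mem_image]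
  constructor
  · rintro ⟨t, ht⟩
    refine ⟨e.symm y, ⟨t, fun h ↦ ht ?_⟩, e.apply_symm_apply y⟩
    rw [h, e.apply_symm_apply]
  · rintro ⟨x, ⟨t, ht⟩, rfl⟩
    refine ⟨t, fun h ↦ ht ?_⟩
    rw [e.symm_apply_apply] at h
    exact e.injective h

end Diffeotopy

/-- A smooth involution of a vector space as a diffeomorphism. [folklore] -/
def Diffeomorph.ofInvolutive {E : Type*} [NormedAddCommGroup E] [NormedSpace ℝ E] (A : E → E)
    (hA : ContDiff ℝ ∞ A) (hAA : ∀ x, A (A x) = x) : E ≃ₘ⟮𝓘(ℝ, E), 𝓘(ℝ, E)⟯ E where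
  toEquiv := ⟨A, A, hAA, hAA⟩
  contMDiff_toFun := hA.contMDiff
  contMDiff_invFun := hA.contMDiff

/-- The involution diffeomorphism as a function. [folklore] -/
@[simp]
theorem Diffeomorph.coe_ofInvolutive {E : Type*} [NormedAddCommGroup E] [NormedSpace ℝ E] (A : E → E)
    (hA : ContDiff ℝ ∞ A) (hAA : ∀ x, A (A x) = x) : ⇑(Diffeomorph.ofInvolutive A hA hAA) = A := rfl

/-- The inverse of the involution diffeomorphism as a function. [folklore] -/
@[simp]
theorem Diffeomorph.coe_ofInvolutive_symm {E : Type*} [NormedAddCommGroup E] [NormedSpace ℝ E]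
    (A : E → E) (hA : ContDiff ℝ ∞ A) (hAA : ∀ x, A (A x) = x) :
    ⇑(Diffeomorph.ofInvolutive A hA hAA).symm = A := rfl

/-! ## Local structure of a knot near an interior point of an arc -/

namespace Knot

/-- **Near a point of an open arc of a knot, the knot is that arc**: if `a < u ≤ a + 1` and
`t₀ ∈ (a, u)`, the point `K (circlePt t₀)` has a neighbourhood meeting `range K` only in
`K ∘ circlePt '' (a, u)` (the complementary closed arc is compact and misses the point).
[folklore] -/
theorem exists_nhds_inter_range_subset (K : Knot) {a u t₀ : ℝ} (hu : u ≤ a + 1) (ht₀ : t₀ ∈ Ioo a u) :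
    ∃ U ∈ 𝓝 (K (circlePt t₀)), ∀ c ∈ U, c ∈ range K → c ∈ (fun t ↦ K (circlePt t)) '' Ioo a u := by
  set S : Set (𝕊 3) := (fun t ↦ K (circlePt t)) '' Icc u (a + 1) with hS
  have hSc : IsCompact S := isCompact_Icc.image (K.continuous.comp continuous_circlePt)
  have hpS : K (circlePt t₀) ∉ S := by
    rintro ⟨t, ht, hpt⟩
    rw [K.apply_circlePt_eq_iff] at hpt
    obtain ⟨m, hm⟩ := hpt
    have h1 : (0 : ℝ) < m := by linarith [ht.1, ht₀.2]
    have h2 : (m : ℝ) < 1 := by linarith [ht.2, ht₀.1]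
    have h1' : (0 : ℤ) < m := by exact_mod_cast h1
    have h2' : m < (1 : ℤ) := by exact_mod_cast h2
    omega
  refine ⟨Sᶜ, hSc.isClosed.isOpen_compl.mem_nhds hpS, ?_⟩
  rintro c hcS ⟨x, rfl⟩
  obtain ⟨t', rfl⟩ : ∃ t', circlePt t' = x := ⟨angA x, circlePt_angA x⟩
  set t : ℝ := t' - ⌊t' - a⌋ with ht
  have hKt : K (circlePt t) = K (circlePt t') := by
    rw [ht, show t' - (⌊t' - a⌋ : ℝ) = t' + ((-⌊t' - a⌋ : ℤ) : ℝ) by push_cast; ring, circlePt_add_int]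
  have htI : t ∈ Ico a (a + 1) := by
    have h1 := Int.floor_le (t' - a)
    have h2 := Int.lt_floor_add_one (t' - a)
    constructor <;> simp only [ht] <;> linarith
  rcases htI.1.eq_or_lt with heq | hgt
  · -- `t = a`: the point `K (circlePt (a + 1)) ∈ S`
    exfalso
    apply hcS
    refine ⟨a + 1, ⟨hu, le_rfl⟩, ?_⟩
    show K (circlePt (a + 1)) = K (circlePt t')
    rw [← hKt, ← heq, show a + 1 = a + ((1 : ℤ) : ℝ) by push_cast; ring, circlePt_add_int]
  · by_cases htu : t < u
    · exact ⟨t, ⟨hgt, htu⟩, hKt⟩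
    · exfalso
      exact hcS ⟨t, ⟨not_lt.1 htu, htI.2.le⟩, hKt⟩

end Knot

/-! ## A transport lemma: points over unmoved parameters are fixed -/

namespace PatchThickening

variable {β : 𝔼 2 → 𝕊 3} {δ₀ δ₁ : ℝ} (T : PatchThickening β δ₀ δ₁)
variable {h : Diffeotopy 𝓘(ℝ, 𝔼 2) (𝔼 2)} {C : Set (𝔼 2)} {z₀ : ℝ}

/-- The transported diffeotopy fixes `emb (y, z)` whenever the parameter `param y` is never moved
by the planar diffeotopy. [folklore] -/
theorem transport_apply_emb_eq_self (hz₀ : 0 < z₀) (hC : IsCompact C) (hCσ : C ⊆ range T.param)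
    (hh : ∀ s, ∀ x ∉ C, h.toFun s x = x) (t : ℝ) {y : 𝔼 2} {z : 𝔼 1}
    (hy : ∀ s, h.toFun s (T.param y) = T.param y) :
    (T.transport hz₀ hC hCσ hh).toFun t (T.emb (slabEquiv.symm (y, z))) = T.emb (slabEquiv.symm (y, z)) := by
  rw [transport_apply_emb, liftFun_symm_apply, T.pull_eq_self (hy _)]

end PatchThickening


namespace PatchThickening

variable {β : 𝔼 2 → 𝕊 3} {δ₀ δ₁ : ℝ} (T : PatchThickening β δ₀ δ₁)

/-- A thickening of a patch is a thickening of any patch equal to it (same data). [folklore] -/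
def copy {β' : 𝔼 2 → 𝕊 3} (h : β' = β) : PatchThickening β' δ₀ δ₁ where
  emb := T.emb
  param := T.param
  isSmoothEmbedding := T.isSmoothEmbedding
  isOpen_range := T.isOpen_range
  contDiff_param := T.contDiff_param
  injective_param := T.injective_param
  injective_fderiv_param := T.injective_fderiv_param
  isOpen_range_param := T.isOpen_range_param
  contDiffOn_invFun_param := T.contDiffOn_invFun_param
  squareNhd_subset := T.squareNhd_subset
  range_param_subset := T.range_param_subset
  emb_inl y := by rw [h]; exact T.emb_inl y

/-- The thickening map of a copy. [folklore] -/
@[simp]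
theorem copy_emb {β' : 𝔼 2 → 𝕊 3} (h : β' = β) : (T.copy h).emb = T.emb := rfl

/-- The parametrisation of a copy. [folklore] -/
@[simp]
theorem copy_param {β' : 𝔼 2 → 𝕊 3} (h : β' = β) : (T.copy h).param = T.param := rfl

/-- The chart of a copy. [folklore] -/
@[simp]
theorem copy_chart {β' : 𝔼 2 → 𝕊 3} (h : β' = β) : (T.copy h).chart = T.chart := rfl

end PatchThickening

/-! ## The two open halves of the collar square -/

/-- The open lower half `{x ∈ squareNhd δ | x₁ < 1/2}` of the collar square, which contains the open
lower arc of band-sum data (`BandData.lowerArc_mem`). [folklore] -/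
def lowerHalf (δ : ℝ) : Set (𝔼 2) := {x ∈ squareNhd δ | x 1 < 2⁻¹}

/-- The open upper half `{x ∈ squareNhd δ | 1/2 < x₁}` of the collar square. [folklore] -/
def upperHalf (δ : ℝ) : Set (𝔼 2) := {x ∈ squareNhd δ | 2⁻¹ < x 1}

/-- Membership in the lower half. [folklore] -/
theorem mem_lowerHalf_iff {δ : ℝ} {x : 𝔼 2} : x ∈ lowerHalf δ ↔ x ∈ squareNhd δ ∧ x 1 < 2⁻¹ := Iff.rfl

/-- Membership in the upper half. [folklore] -/
theorem mem_upperHalf_iff {δ : ℝ} {x : 𝔼 2} : x ∈ upperHalf δ ↔ x ∈ squareNhd δ ∧ 2⁻¹ < x 1 := Iff.rfl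

/-- The half-turn exchanges the two halves. [folklore] -/
theorem pt2_one_one_sub_mem_upperHalf_iff {δ : ℝ} {x : 𝔼 2} : pt2 1 1 - x ∈ upperHalf δ ↔ x ∈ lowerHalf δ := by
  rw [mem_upperHalf_iff, mem_lowerHalf_iff, pt2_one_one_sub_mem_squareNhd_iff, pt2_one_one_sub_apply]
  constructor <;> rintro ⟨h1, h2⟩ <;> exact ⟨h1, by linarith⟩

/-- The two halves are disjoint. [folklore] -/
theorem disjoint_lowerHalf_upperHalf (δ : ℝ) : Disjoint (lowerHalf δ) (upperHalf δ) :=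
  Set.disjoint_left.2 fun _ h1 h2 ↦ by linarith [h1.2, h2.2]

/-! ## Arc images and the half-turn of the parameter plane -/

section ArcImages

/-- The open part of a planar arc from `A` to `B` through the open lower half is the closed arc
minus its endpoints. [folklore] -/
theorem image_Ioo_eq_image_Icc_diff {l : ℝ → 𝔼 2} {A B : 𝔼 2} (h0 : l 0 = A) (h1 : l 1 = B)
    (hA : ∀ t ∈ Ioo (0 : ℝ) 1, l t ≠ A) (hB : ∀ t ∈ Ioo (0 : ℝ) 1, l t ≠ B) :
    l '' Ioo 0 1 = l '' Icc 0 1 \ {A, B} := by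
  ext x
  constructor
  · rintro ⟨t, ht, rfl⟩
    exact ⟨⟨t, Ioo_subset_Icc_self ht, rfl⟩, by
      simp only [mem_insert_iff, mem_singleton_iff, not_or]; exact ⟨hA t ht, hB t ht⟩⟩
  · rintro ⟨⟨t, ht, rfl⟩, hne⟩
    simp only [mem_insert_iff, mem_singleton_iff, not_or] at hne
    refine ⟨t, ⟨lt_of_le_of_ne ht.1 ?_, lt_of_le_of_ne ht.2 ?_⟩, rfl⟩
    · rintro rfl; exact hne.1 h0
    · rintro rfl; exact hne.2 h1

/-- A bijection fixing two points maps a set minus them onto the image minus them. [folklore] -/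
theorem image_diff_pair_of_apply_eq {α : Type*} {f : α → α} (hf : Injective f) {S : Set α} {A B : α}
    (hA : f A = A) (hB : f B = B) : f '' (S \ {A, B}) = f '' S \ {A, B} := by
  rw [image_sdiff hf, image_insert_eq, image_singleton, hA, hB]

end ArcImages

namespace BandData

variable {K₁ K₂ K K' : Knot} {avoid avoid' : Set (𝕊 3)}

/-- The open lower arc avoids the two lower corners. [folklore] -/
theorem lowerArc_ne_corner (b : BandData K₁ K₂ K avoid) {t : ℝ} (ht : t ∈ Ioo (0 : ℝ) 1) (a : ℝ) :
    b.lowerArc t ≠ pt2 a (-b.δ) := by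
  intro h
  have h1 := ((b.lowerArc_mem t ht).1 1).1
  rw [h, pt2_apply_one] at h1
  exact lt_irrefl _ h1

/-- The open upper arc avoids the two upper corners. [folklore] -/
theorem upperArc_ne_corner (b : BandData K₁ K₂ K avoid) {t : ℝ} (ht : t ∈ Ioo (0 : ℝ) 1) (a : ℝ) :
    b.upperArc t ≠ pt2 a (1 + b.δ) := by
  intro h
  have h1 := ((b.upperArc_mem t ht).1 1).2
  rw [h, pt2_apply_one] at h1
  exact lt_irrefl _ h1

/-- The open lower arc is the closed lower arc minus the corners `A`, `B`. [folklore] -/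
theorem lowerArc_image_Ioo (b : BandData K₁ K₂ K avoid) :
    b.lowerArc '' Ioo 0 1 = b.lowerArc '' Icc 0 1 \ {pt2 0 (-b.δ), pt2 1 (-b.δ)} :=
  image_Ioo_eq_image_Icc_diff b.lowerArc_zero b.lowerArc_one (fun _ ht ↦ b.lowerArc_ne_corner ht 0)
    (fun _ ht ↦ b.lowerArc_ne_corner ht 1)

/-- The open upper arc is the closed upper arc minus the corners `B'`, `A'`. [folklore] -/
theorem upperArc_image_Ioo (b : BandData K₁ K₂ K avoid) :
    b.upperArc '' Ioo 0 1 = b.upperArc '' Icc 0 1 \ {pt2 1 (1 + b.δ), pt2 0 (1 + b.δ)} :=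
  image_Ioo_eq_image_Icc_diff b.upperArc_zero b.upperArc_one (fun _ ht ↦ b.upperArc_ne_corner ht 1)
    (fun _ ht ↦ b.upperArc_ne_corner ht 0)

/-- The closed lower arc lies in `{x₁ < 1/2}`. [folklore] -/
theorem lowerArc_apply_one_lt (b : BandData K₁ K₂ K avoid) {t : ℝ} (ht : t ∈ Icc (0 : ℝ) 1) :
    b.lowerArc t 1 < 2⁻¹ := by
  have hδ := b.δ_pos
  rcases ht.1.eq_or_lt with rfl | h0
  · rw [b.lowerArc_zero, pt2_apply_one]; linarith
  rcases ht.2.eq_or_lt with rfl | h1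
  · rw [b.lowerArc_one, pt2_apply_one]; linarith
  exact (b.lowerArc_mem t ⟨h0, h1⟩).2

/-- The closed upper arc lies in `{1/2 < x₁}`. [folklore] -/
theorem lt_upperArc_apply_one (b : BandData K₁ K₂ K avoid) {t : ℝ} (ht : t ∈ Icc (0 : ℝ) 1) :
    2⁻¹ < b.upperArc t 1 := by
  have hδ := b.δ_pos
  rcases ht.1.eq_or_lt with rfl | h0
  · rw [b.upperArc_zero, pt2_apply_one]; linarith
  rcases ht.2.eq_or_lt with rfl | h1
  · rw [b.upperArc_one, pt2_apply_one]; linarith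
  exact (b.upperArc_mem t ⟨h0, h1⟩).2

/-- The half-turn as a diffeomorphism of the plane. [folklore] -/
def halfTurnDiffeo : 𝔼 2 ≃ₘ⟮𝓘(ℝ, 𝔼 2), 𝓘(ℝ, 𝔼 2)⟯ 𝔼 2 :=
  Diffeomorph.ofInvolutive (fun x : 𝔼 2 ↦ pt2 1 1 - x) (contDiff_const.sub contDiff_id)
    (fun x ↦ sub_sub_cancel _ x)

/-- The half-turn diffeomorphism as a function. [folklore] -/
@[simp]
theorem coe_halfTurnDiffeo : ⇑(halfTurnDiffeo : 𝔼 2 ≃ₘ⟮𝓘(ℝ, 𝔼 2), 𝓘(ℝ, 𝔼 2)⟯ 𝔼 2) = fun x ↦ pt2 1 1 - x := rfl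

/-- The inverse half-turn diffeomorphism as a function. [folklore] -/
@[simp]
theorem coe_halfTurnDiffeo_symm :
    ⇑(halfTurnDiffeo : 𝔼 2 ≃ₘ⟮𝓘(ℝ, 𝔼 2), 𝓘(ℝ, 𝔼 2)⟯ 𝔼 2).symm = fun x ↦ pt2 1 1 - x := rfl

/-- The image of a ball under the half-turn. [folklore] -/
theorem image_halfTurn_ball (c : 𝔼 2) (r : ℝ) :
    (fun x : 𝔼 2 ↦ pt2 1 1 - x) '' ball c r = ball (pt2 1 1 - c) r := by
  ext x
  constructor
  · rintro ⟨y, hy, rfl⟩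
    rwa [mem_ball, dist_pt2_one_one_sub]
  · intro hx
    refine ⟨pt2 1 1 - x, ?_, sub_sub_cancel _ _⟩
    rw [mem_ball, ← dist_pt2_one_one_sub, sub_sub_cancel]; exact hx

/-- The image of the lower half under the half-turn. [folklore] -/
theorem image_halfTurn_lowerHalf (δ : ℝ) : (fun x : 𝔼 2 ↦ pt2 1 1 - x) '' lowerHalf δ = upperHalf δ := by
  ext x
  constructor
  · rintro ⟨y, hy, rfl⟩; exact pt2_one_one_sub_mem_upperHalf_iff.2 hy
  · intro hx
    exact ⟨pt2 1 1 - x, pt2_one_one_sub_mem_upperHalf_iff.1 (by rwa [sub_sub_cancel]), sub_sub_cancel _ _⟩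

/-- The half-turn is an involution on sets. [folklore] -/
theorem image_halfTurn_image_halfTurn (S : Set (𝔼 2)) :
    (fun x : 𝔼 2 ↦ pt2 1 1 - x) '' ((fun x : 𝔼 2 ↦ pt2 1 1 - x) '' S) = S := by
  rw [image_image]; simp

end BandData

/-! ## Transport infrastructure for planar diffeotopies of the arc systems -/

section DerivAgree

variable {F : Type*} [NormedAddCommGroup F] [NormedSpace ℝ F]

/-- Two functions differentiable at `a` which agree on a left neighbourhood `(a - ε, a]` have the
same derivative at `a` (the derivative is the left derivative). [folklore] -/
theorem deriv_eq_of_eventuallyEq_nhdsLE {f g : ℝ → F} {a : ℝ} (hf : DifferentiableAt ℝ f a)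
    (hg : DifferentiableAt ℝ g a) (h : ∀ᶠ t in 𝓝[≤] a, f t = g t) : deriv f a = deriv g a := by
  rw [← hf.derivWithin (uniqueDiffWithinAt_Iic a), ← hg.derivWithin (uniqueDiffWithinAt_Iic a)]
  exact EventuallyEq.derivWithin_eq (show f =ᶠ[𝓝[Iic a] a] g from h)
    (h.self_of_nhdsWithin (mem_Iic.2 le_rfl))

end DerivAgree

/-- The corners of the collar square lie in its closure. [folklore] -/
theorem pt2_mem_closure_squareNhd {δ : ℝ} (hδ : 0 < δ) {a c : ℝ} (ha : a ∈ Icc (0 : ℝ) 1)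
    (hc : c = -δ ∨ c = 1 + δ) : pt2 a c ∈ closure (squareNhd δ) := by
  -- approach the corner along the vertical segment into the square
  have hσ : ∃ σ : ℝ, (σ = 1 ∨ σ = -1) ∧ ∀ ε ∈ Ioo (0 : ℝ) (2 * δ), c + σ * ε ∈ Ioo (-δ) (1 + δ) := by
    rcases hc with rfl | rfl
    · exact ⟨1, Or.inl rfl, fun ε hε ↦ ⟨by linarith [hε.1], by nlinarith [hε.2, ha.1]⟩⟩
    · exact ⟨-1, Or.inr rfl, fun ε hε ↦ ⟨by nlinarith [hε.2], by linarith [hε.1]⟩⟩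
  obtain ⟨σ, -, hσ⟩ := hσ
  have hcont : Tendsto (fun ε : ℝ ↦ pt2 a (c + σ * ε)) (𝓝[>] 0) (𝓝 (pt2 a c)) := by
    have : Continuous fun ε : ℝ ↦ pt2 a (c + σ * ε) := continuous_pt2_right a |>.comp (by fun_prop)
    have h0 := this.tendsto 0
    simp only [mul_zero, add_zero] at h0
    exact h0.mono_left nhdsWithin_le_nhds
  refine mem_closure_of_tendsto hcont ?_
  filter_upwards [Ioo_mem_nhdsGT (show (0 : ℝ) < 2 * δ by linarith)] with ε hε
  intro i
  fin_cases i
  · show (pt2 a (c + σ * ε)) 0 ∈ Ioo (-δ) (1 + δ)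
    rw [pt2_apply_zero]; exact ⟨by linarith [ha.1], by linarith [ha.2]⟩
  · show (pt2 a (c + σ * ε)) 1 ∈ Ioo (-δ) (1 + δ)
    rw [pt2_apply_one]; exact hσ ε hε

namespace BandData

variable {K₁ K₂ K K' : Knot} {avoid avoid' : Set (𝕊 3)} (b : BandData K₁ K₂ K avoid)
variable {δ₀ δ₁ : ℝ} (T : PatchThickening b.band δ₀ δ₁)

/-- The band at a corner of the collar square lies in the closure of the band surface. [folklore] -/
theorem band_corner_mem_closure_support {a c : ℝ} (ha : a ∈ Icc (0 : ℝ) 1) (hc : c = -b.δ ∨ c = 1 + b.δ) :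
    b.band (pt2 a c) ∈ closure b.support :=
  image_closure_subset_closure_image b.contMDiff.continuous ⟨_, pt2_mem_closure_squareNhd b.δ_pos ha hc, rfl⟩

/-- **`K` meets the band surface in the two open arcs.** [folklore] -/
theorem mem_arcs_of_mem_support {c : 𝕊 3} (hc : c ∈ range K) (hcs : c ∈ b.support) :
    c ∈ b.lowerCurve '' Ioo 0 1 ∨ c ∈ b.upperCurve '' Ioo 0 1 := by
  obtain ⟨q, hq, rfl⟩ := hcs
  have hmem : q ∈ b.band ⁻¹' range K ∩ squareNhd b.δ := ⟨hc, hq⟩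
  rw [b.preimage_range] at hmem
  rcases hmem with ⟨s, hs, rfl⟩ | ⟨s, hs, rfl⟩
  · exact Or.inl ⟨s, hs, rfl⟩
  · exact Or.inr ⟨s, hs, rfl⟩

/-- The open upper arc, on `𝕊³`, lies in the band surface. [folklore] -/
theorem upperCurve_mem_support {s : ℝ} (hs : s ∈ Ioo (0 : ℝ) 1) : b.upperCurve s ∈ b.support :=
  ⟨b.upperArc s, (b.upperArc_mem s hs).1, rfl⟩

/-- `range K` splits into its part off the band surface and the two open arcs. [folklore] -/
theorem range_eq_diff_union_arcs :
    range K = (range K \ b.support) ∪ (b.lowerCurve '' Ioo 0 1 ∪ b.upperCurve '' Ioo 0 1) := by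
  apply Subset.antisymm
  · intro c hc
    by_cases hcs : c ∈ b.support
    · exact Or.inr (b.mem_arcs_of_mem_support hc hcs)
    · exact Or.inl ⟨hc, hcs⟩
  · rintro c (⟨hc, -⟩ | (⟨s, hs, rfl⟩ | ⟨s, hs, rfl⟩))
    · exact hc
    · exact b.band_lowerArc_mem (Ioo_subset_Icc_self hs)
    · exact b.band_upperArc_mem (Ioo_subset_Icc_self hs)

/-- Band-sum data with the same band and collar have the same band surface. [folklore] -/
theorem support_eq_of_band_eq (b' : BandData K₁ K₂ K' avoid') (hband : b'.band = b.band) (hδ : b'.δ = b.δ) :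
    b'.support = b.support := by
  show b'.band '' squareNhd b'.δ = b.band '' squareNhd b.δ
  rw [hband, hδ]

/-- Band-sum data with the same band and collar have results with the same part off the band
surface. [folklore] -/
theorem range_diff_support_eq (b' : BandData K₁ K₂ K' avoid') (hband : b'.band = b.band) (hδ : b'.δ = b.δ) :
    range K' \ b'.support = range K \ b.support := by
  have h1 : range K' \ b'.support = (range K₁ ∪ range K₂) \ b'.support := b'.range_diff
  have h2 : range K \ b.support = (range K₁ ∪ range K₂) \ b.support := b.range_diff
  rw [h1, h2, b.support_eq_of_band_eq b' hband hδ]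

/-- Band-sum data with the same band and collar have the same left edge. [folklore] -/
theorem leftEdge_eq_of_band_eq (b' : BandData K₁ K₂ K' avoid') (hband : b'.band = b.band) (hδ : b'.δ = b.δ) :
    b'.leftEdge = b.leftEdge := by
  funext s
  rw [leftEdge_apply, leftEdge_apply, hband, hδ]

/-! ### The stationarity tube -/

/-- **A tube about the band image of a compact parameter set stays in a neighbourhood**: if
`band '' C ⊆ V` with `V` open and `C ⊆ range param` compact, then all points `emb (y, z)` with
`param y ∈ C` and `‖z‖ ≤ z₁` lie in `V`, for some `z₁ > 0` (generalised tube lemma). [folklore] -/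
theorem exists_tube_subset {C : Set (𝔼 2)} (hC : IsCompact C) (hCσ : C ⊆ range T.param) {V : Set (𝕊 3)}
    (hV : IsOpen V) (hCV : ∀ x ∈ C, b.band x ∈ V) :
    ∃ z₁ > 0, ∀ (y : 𝔼 2) (z : 𝔼 1), T.param y ∈ C → ‖z‖ ≤ z₁ → T.emb (slabEquiv.symm (y, z)) ∈ V := by
  set G : (𝔼 2) × (𝔼 1) → 𝕊 3 := fun q ↦ T.emb (slabEquiv.symm q) with hG
  have hGc : Continuous G :=
    T.isSmoothEmbedding.contMDiff.continuous.comp slabEquiv.symm.continuous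
  set Kc : Set (𝔼 2) := T.paramInv '' C with hKc
  have hKcc : IsCompact Kc := hC.image_of_continuousOn (T.contDiffOn_paramInv.continuousOn.mono hCσ)
  have hsub : Kc ×ˢ ({0} : Set (𝔼 1)) ⊆ G ⁻¹' V := by
    rintro ⟨y, z⟩ ⟨⟨x, hx, rfl⟩, hz⟩
    rw [mem_singleton_iff] at hz
    subst hz
    show T.emb (slabEquiv.symm (T.paramInv x, 0)) ∈ V
    rw [T.emb_inl, T.param_paramInv (hCσ hx)]
    exact hCV x hx
  obtain ⟨U, W, hU, hW, hKU, h0W, hUW⟩ :=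
    generalized_tube_lemma hKcc isCompact_singleton (hV.preimage hGc) hsub
  obtain ⟨z₁, hz₁, hz₁W⟩ := Metric.mem_nhds_iff.1 (hW.mem_nhds (h0W (mem_singleton 0)))
  refine ⟨z₁ / 2, by positivity, fun y z hy hz ↦ ?_⟩
  have hyU : y ∈ U := hKU ⟨T.param y, hy, T.paramInv_param y⟩
  have hzW : z ∈ W := hz₁W (by rw [mem_ball, dist_zero_right]; linarith)
  exact hUW (mk_mem_prod hyU hzW)

/-! ### Points of `K` off the band surface stay off the moved slab -/

/-- `emb` is an open map. [folklore] -/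
theorem _root_.Literature.Topology.FourManifolds.PatchThickening.isOpenMap_emb {β : 𝔼 2 → 𝕊 3} {δ₀ δ₁ : ℝ}
    (T : PatchThickening β δ₀ δ₁) : IsOpenMap T.emb :=
  (Topology.IsOpenEmbedding.mk T.isSmoothEmbedding.isEmbedding T.isOpen_range).isOpenMap

/-- Slab coordinates are determined by the point. [folklore] -/
theorem _root_.Literature.Topology.FourManifolds.PatchThickening.eq_of_emb_eq {β : 𝔼 2 → 𝕊 3} {δ₀ δ₁ : ℝ}
    (T : PatchThickening β δ₀ δ₁) {y y' : 𝔼 2} {z z' : 𝔼 1}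
    (h : T.emb (slabEquiv.symm (y, z)) = T.emb (slabEquiv.symm (y', z'))) : y = y' ∧ z = z' := by
  have := slabEquiv.symm.injective (T.injective_emb h)
  exact Prod.mk.injEq _ _ _ _ ▸ this |> fun h ↦ by simpa using h

variable (h : Diffeotopy 𝓘(ℝ, 𝔼 2) (𝔼 2)) {C : Set (𝔼 2)}

/-- The property "points of `K` in `S`, off the band surface, at height `< z` over the thickening,
lie over parameters never moved by `h`", for some `z > 0`. [folklore] -/
def FixesOff (S : Set (𝕊 3)) : Prop :=
  ∃ z > 0, ∀ c ∈ S, c ∈ range K → c ∉ b.support → ∀ (y : 𝔼 2) (z' : 𝔼 1),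
    c = T.emb (slabEquiv.symm (y, z')) → ‖z'‖ < z → T.param y ∉ h.movedSet

/-- `FixesOff` holds for the empty set. [folklore] -/
theorem fixesOff_empty : b.FixesOff T h ∅ := ⟨1, one_pos, fun _ h ↦ h.elim⟩

/-- `FixesOff` is antitone in the set. [folklore] -/
theorem fixesOff_mono {S S' : Set (𝕊 3)} (hSS' : S ⊆ S') (hS' : b.FixesOff T h S') : b.FixesOff T h S := by
  obtain ⟨z, hz, hS'⟩ := hS'
  exact ⟨z, hz, fun c hc ↦ hS' c (hSS' hc)⟩

/-- `FixesOff` is finitely additive. [folklore] -/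
theorem fixesOff_union {S S' : Set (𝕊 3)} (hS : b.FixesOff T h S) (hS' : b.FixesOff T h S') :
    b.FixesOff T h (S ∪ S') := by
  obtain ⟨z, hz, hS⟩ := hS
  obtain ⟨z', hz', hS'⟩ := hS'
  refine ⟨min z z', lt_min hz hz', ?_⟩
  rintro c (hc | hc) hcK hcs y w hcw hw
  · exact hS c hc hcK hcs y w hcw (lt_of_lt_of_le hw (min_le_left _ _))
  · exact hS' c hc hcK hcs y w hcw (lt_of_lt_of_le hw (min_le_right _ _))

variable {h}

/-- The moved set of a planar diffeotopy `h` moving points only inside `C` and the two open halves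
lies in the open collar square, and its closure in the closed strip `{-δ ≤ x₁ ≤ 1 + δ}`.
[folklore] -/
theorem movedSet_apply_one (hM : ∀ x ∈ h.movedSet, x ∈ C ∧ (x ∈ lowerHalf b.δ ∨ x ∈ upperHalf b.δ)) :
    (∀ x ∈ h.movedSet, x ∈ squareNhd b.δ) ∧ ∀ x ∈ closure h.movedSet, -b.δ ≤ x 1 ∧ x 1 ≤ 1 + b.δ := by
  have h1 : ∀ x ∈ h.movedSet, x ∈ squareNhd b.δ := fun x hx ↦ by
    rcases (hM x hx).2 with h | h
    · exact h.1
    · exact h.1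
  refine ⟨h1, ?_⟩
  have hcl : closure h.movedSet ⊆ {x : 𝔼 2 | -b.δ ≤ x 1 ∧ x 1 ≤ 1 + b.δ} := by
    refine closure_minimal (fun x hx ↦ ?_) ?_
    · have := (h1 x hx) 1
      exact ⟨this.1.le, this.2.le⟩
    · have : {x : 𝔼 2 | -b.δ ≤ x 1 ∧ x 1 ≤ 1 + b.δ} = (fun x : 𝔼 2 ↦ x 1) ⁻¹' Icc (-b.δ) (1 + b.δ) := by
        ext x; simp [mem_Icc]
      rw [this]
      exact isClosed_Icc.preimage (EuclideanSpace.proj (1 : Fin 2)).continuous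
  exact fun x hx ↦ hcl hx

/-- **Near an attaching point, off-band points of `K` lie over unmoved parameters** (no height
restriction needed): by the local result (C1) at that corner, nearby points of `K` off the band
surface are the attaching point itself (over the corner, which is never moved) or project outside
the closed strip `{-δ ≤ x₁ ≤ 1 + δ} ⊇ movedSet`. [folklore] -/
theorem fixesOff_nhds_corner (hM : ∀ x ∈ h.movedSet, x ∈ C ∧ (x ∈ lowerHalf b.δ ∨ x ∈ upperHalf b.δ))
    {corner : 𝔼 2} (hcσ : corner ∈ range T.param) (hc1 : corner 1 = -b.δ ∨ corner 1 = 1 + b.δ)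
    {rc : ℝ} (hrc : 0 < rc)
    (hC1 : ∀ c ∈ range K, dist c (b.band corner) < rc → c ∉ b.support → c ≠ b.band corner →
      c ∈ range T.emb ∧ (T.planar c 1 < -b.δ ∨ 1 + b.δ < T.planar c 1)) :
    ∃ U ∈ 𝓝 (b.band corner), b.FixesOff T h U := by
  refine ⟨ball (b.band corner) rc, ball_mem_nhds _ hrc, 1, one_pos, ?_⟩
  intro c hc hcK hcs y w hcw _ hmoved
  have hsq := (b.movedSet_apply_one hM).1 _ hmoved
  by_cases hne : c = b.band corner
  · -- over the corner itself
    obtain ⟨yc, hyc⟩ := hcσ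
    have : T.emb (slabEquiv.symm (y, w)) = T.emb (slabEquiv.symm (yc, 0)) := by
      rw [← hcw, hne, T.emb_inl, hyc]
    obtain ⟨rfl, -⟩ := T.eq_of_emb_eq this
    rw [hyc] at hsq
    have h1 := hsq 1
    rcases hc1 with h | h <;> rw [h] at h1
    · exact lt_irrefl _ h1.1
    · exact lt_irrefl _ h1.2
  · obtain ⟨-, hlt⟩ := hC1 c hcK (mem_ball.1 hc) hcs hne
    rw [hcw, T.planar_emb] at hlt
    have h1 := hsq 1
    rcases hlt with hlt | hlt
    · linarith [h1.1]
    · linarith [h1.2]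

/-- **Away from the image of the thickening** nothing needs fixing: a neighbourhood missing the
compact set `emb (param⁻¹ C × B̄(0, 1))`. [folklore] -/
theorem fixesOff_nhds_of_not_mem_range (hMC : h.movedSet ⊆ C) (hCc : IsCompact C) (hCσ : C ⊆ range T.param)
    {c : 𝕊 3} (hc : c ∉ range T.emb) : ∃ U ∈ 𝓝 c, b.FixesOff T h U := by
  set E : Set (𝕊 3) := (fun q : (𝔼 2) × 𝔼 1 ↦ T.emb (slabEquiv.symm q)) ''
    ((T.paramInv '' C) ×ˢ closedBall (0 : 𝔼 1) 1) with hE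
  have hEc : IsCompact E :=
    ((hCc.image_of_continuousOn (T.contDiffOn_paramInv.continuousOn.mono hCσ)).prod
      (isCompact_closedBall 0 1)).image
      (T.isSmoothEmbedding.contMDiff.continuous.comp slabEquiv.symm.continuous)
  have hcE : c ∉ E := fun ⟨q, _, hq⟩ ↦ hc ⟨_, hq⟩
  refine ⟨Eᶜ, hEc.isClosed.isOpen_compl.mem_nhds hcE, 1, one_pos, ?_⟩
  intro c' hc' _ _ y w hcw hw hmoved
  apply hc'
  refine ⟨(y, w), ⟨⟨T.param y, hMC hmoved, T.paramInv_param y⟩, ?_⟩, hcw.symm⟩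
  rw [mem_closedBall, dist_zero_right]
  exact hw.le

/-- **At nonzero height** nothing needs fixing below half that height. [folklore] -/
theorem fixesOff_nhds_of_height_ne {y₀ : 𝔼 2} {z₀ : 𝔼 1} (hz₀ : z₀ ≠ 0) :
    ∃ U ∈ 𝓝 (T.emb (slabEquiv.symm (y₀, z₀))), b.FixesOff T h U := by
  set U : Set (𝕊 3) := T.emb '' {v | ‖z₀‖ / 2 < ‖(slabEquiv v).2‖} with hU
  have hUo : IsOpen U := T.isOpenMap_emb _
    (isOpen_lt continuous_const (continuous_norm.comp (continuous_snd.comp slabEquiv.continuous)))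
  have hz₀' : 0 < ‖z₀‖ := norm_pos_iff.2 hz₀
  have hcU : T.emb (slabEquiv.symm (y₀, z₀)) ∈ U :=
    ⟨_, by simp only [mem_setOf_eq, ContinuousLinearEquiv.apply_symm_apply]; linarith, rfl⟩
  refine ⟨U, hUo.mem_nhds hcU, ‖z₀‖ / 2, by positivity, ?_⟩
  rintro c ⟨v, hv, rfl⟩ _ _ y w hcw hw _
  rw [T.injective_emb hcw] at hv
  simp only [mem_setOf_eq, ContinuousLinearEquiv.apply_symm_apply] at hv
  linarith

/-- **Over parameters outside the closure of the moved set** nothing needs fixing. [folklore] -/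
theorem fixesOff_nhds_of_not_mem_closure {y₀ : 𝔼 2} (hy₀ : T.param y₀ ∉ closure h.movedSet) (z₀ : 𝔼 1) :
    ∃ U ∈ 𝓝 (T.emb (slabEquiv.symm (y₀, z₀))), b.FixesOff T h U := by
  set U : Set (𝕊 3) := T.emb '' {v | T.param (slabEquiv v).1 ∉ closure h.movedSet} with hU
  have hUo : IsOpen U := T.isOpenMap_emb _ (isClosed_closure.isOpen_compl.preimage
    (T.contDiff_param.continuous.comp (continuous_fst.comp slabEquiv.continuous)))
  have hcU : T.emb (slabEquiv.symm (y₀, z₀)) ∈ U :=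
    ⟨_, by simpa only [mem_setOf_eq, ContinuousLinearEquiv.apply_symm_apply] using hy₀, rfl⟩
  refine ⟨U, hUo.mem_nhds hcU, 1, one_pos, ?_⟩
  rintro c ⟨v, hv, rfl⟩ _ _ y w hcw _ hmoved
  rw [T.injective_emb hcw] at hv
  simp only [mem_setOf_eq, ContinuousLinearEquiv.apply_symm_apply] at hv
  exact hv (subset_closure hmoved)

/-- **Near a point of the open lower arc, `K` lies in the band surface**, so nothing needs fixing.
[folklore] -/
theorem fixesOff_nhds_of_mem_lowerCurve (hδ₁ : b.δ < δ₁) {s : ℝ} (hs : s ∈ Ioo (0 : ℝ) 1) :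
    ∃ U ∈ 𝓝 (b.lowerCurve s), b.FixesOff T h U := by
  obtain ⟨φ, hφ, hφm, hφℓ⟩ := b.exists_lift_lowerCurve
  have hφ1 := b.lift_lowerCurve_one_lt (b.injOn_band_closedSquare T hδ₁) hφ hφm hφℓ
  have ht : φ s ∈ Ioo (φ 0) (φ 1) :=
    ⟨hφm (left_mem_Icc.2 zero_le_one) (Ioo_subset_Icc_self hs) hs.1,
      hφm (Ioo_subset_Icc_self hs) (right_mem_Icc.2 zero_le_one) hs.2⟩
  obtain ⟨U, hU, hUsub⟩ := K.exists_nhds_inter_range_subset hφ1.le ht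
  rw [hφℓ s (Ioo_subset_Icc_self hs)] at hU
  refine ⟨U, hU, 1, one_pos, fun c hc hcK hcs ↦ absurd ?_ hcs⟩
  obtain ⟨t, ht', rfl⟩ := hUsub c hc hcK
  obtain ⟨s', hs', hs'e⟩ := b.apply_circlePt_mem_lowerCurve_image hφ hφm hφℓ ht'
  show K (circlePt t) ∈ b.support
  rw [← hs'e]
  exact b.lowerCurve_mem_support hs'

/-- **Near a point of the open upper arc, `K` lies in the band surface** (the lower-arc statement
for the half-turned data). [folklore] -/
theorem fixesOff_nhds_of_mem_upperCurve (hδ₁ : b.δ < δ₁) (hdisj : Disjoint (range K₁) (range K₂))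
    {s : ℝ} (hs : s ∈ Ioo (0 : ℝ) 1) : ∃ U ∈ 𝓝 (b.upperCurve s), b.FixesOff T h U := by
  set bR := b.halfTurn hdisj with hbR
  obtain ⟨φ, hφ, hφm, hφℓ⟩ := bR.exists_lift_lowerCurve
  have hφ1 := bR.lift_lowerCurve_one_lt (bR.injOn_band_closedSquare T.halfTurn hδ₁) hφ hφm hφℓ
  have ht : φ s ∈ Ioo (φ 0) (φ 1) :=
    ⟨hφm (left_mem_Icc.2 zero_le_one) (Ioo_subset_Icc_self hs) hs.1,
      hφm (Ioo_subset_Icc_self hs) (right_mem_Icc.2 zero_le_one) hs.2⟩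
  obtain ⟨U, hU, hUsub⟩ := K.exists_nhds_inter_range_subset hφ1.le ht
  rw [hφℓ s (Ioo_subset_Icc_self hs), hbR, halfTurn_lowerCurve] at hU
  refine ⟨U, hU, 1, one_pos, fun c hc hcK hcs ↦ absurd ?_ hcs⟩
  obtain ⟨t, ht', rfl⟩ := hUsub c hc hcK
  obtain ⟨s', hs', hs'e⟩ := bR.apply_circlePt_mem_lowerCurve_image hφ hφm hφℓ ht'
  show K (circlePt t) ∈ b.support
  rw [← hs'e, ← b.halfTurn_support hdisj]
  exact bR.lowerCurve_mem_support hs'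

/-- Near a corner and outside the open collar square, a point of the closed strip lies on the
corner's edge line. [folklore] -/
theorem apply_one_eq_of_near_corner {x : 𝔼 2} {a c r : ℝ} (ha : a ∈ Icc (0 : ℝ) 1)
    (hc : c = -b.δ ∨ c = 1 + b.δ) (hr : r ≤ b.δ) (hdist : dist x (pt2 a c) < r)
    (hsq : x ∉ squareNhd b.δ) (hstrip : -b.δ ≤ x 1 ∧ x 1 ≤ 1 + b.δ) : x 1 = c := by
  have hδ := b.δ_pos
  have h0 : |x 0 - a| < r := by
    have := PiLp.dist_apply_le x (pt2 a c) 0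
    rw [pt2_apply_zero, Real.dist_eq] at this
    exact lt_of_le_of_lt this hdist
  have h1 : |x 1 - c| < r := by
    have := PiLp.dist_apply_le x (pt2 a c) 1
    rw [pt2_apply_one, Real.dist_eq] at this
    exact lt_of_le_of_lt this hdist
  rw [abs_lt] at h0 h1
  have hx0 : x 0 ∈ Ioo (-b.δ) (1 + b.δ) := ⟨by linarith [ha.1], by linarith [ha.2]⟩
  have hx1 : x 1 ∉ Ioo (-b.δ) (1 + b.δ) := by
    intro h
    apply hsq
    intro i
    fin_cases i
    · exact hx0
    · exact h
  rw [mem_Ioo, not_and_or, not_lt, not_lt] at hx1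
  rcases hc with rfl | rfl
  · rcases hx1 with h | h
    · linarith
    · linarith
  · rcases hx1 with h | h
    · linarith
    · linarith

/-- **Control at a corner**: a radius `rc` on which the local result (C1) holds at the attaching
point `band corner`, and such that the band maps the `r`-ball about the corner into the `rc`-ball
about the attaching point. [folklore] -/
def CornerControl (corner : 𝔼 2) (r : ℝ) : Prop :=
  ∃ rc > 0, (∀ c ∈ range K, dist c (b.band corner) < rc → c ∉ b.support → c ≠ b.band corner →
      c ∈ range T.emb ∧ (T.planar c 1 < -b.δ ∨ 1 + b.δ < T.planar c 1)) ∧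
    ∀ x : 𝔼 2, dist x corner < r → dist (b.band x) (b.band corner) < rc

/-- Corner control shrinks with the radius. [folklore] -/
theorem CornerControl.mono {corner : 𝔼 2} {r r' : ℝ} (h : b.CornerControl T corner r) (hr : r' ≤ r) :
    b.CornerControl T corner r' := by
  obtain ⟨rc, hrc, h1, h2⟩ := h
  exact ⟨rc, hrc, h1, fun x hx ↦ h2 x (lt_of_lt_of_le hx hr)⟩

/-- From a (C1) statement at a corner to corner control for all small radii. [folklore] -/
theorem exists_cornerControl {corner : 𝔼 2} {rc : ℝ} (hrc : 0 < rc)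
    (hC1 : ∀ c ∈ range K, dist c (b.band corner) < rc → c ∉ b.support → c ≠ b.band corner →
      c ∈ range T.emb ∧ (T.planar c 1 < -b.δ ∨ 1 + b.δ < T.planar c 1)) :
    ∃ r₀ > 0, ∀ r ≤ r₀, b.CornerControl T corner r := by
  obtain ⟨r₀, hr₀, hsub⟩ := Metric.mem_nhds_iff.1
    (b.contMDiff.continuous.continuousAt.preimage_mem_nhds (ball_mem_nhds (b.band corner) hrc))
  exact ⟨r₀, hr₀, fun r hr ↦ ⟨rc, hrc, hC1, fun x hx ↦ hsub (lt_of_lt_of_le hx hr)⟩⟩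

/-- Corner control at the four corners, for all small radii. [folklore] -/
theorem exists_cornerControl_all (hδ₁ : b.δ < δ₁) (hdisj : Disjoint (range K₁) (range K₂)) :
    ∃ r₀ > 0, ∀ r ≤ r₀, b.CornerControl T (pt2 0 (-b.δ)) r ∧ b.CornerControl T (pt2 1 (-b.δ)) r ∧
      b.CornerControl T (pt2 1 (1 + b.δ)) r ∧ b.CornerControl T (pt2 0 (1 + b.δ)) r := by
  obtain ⟨rA, hrA, hA⟩ := b.exists_radius_planar_one_lt T hδ₁ hdisj
  obtain ⟨rB, hrB, hB⟩ := b.exists_radius_planar_one_lt_right T hδ₁ hdisj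
  obtain ⟨rB', hrB', hB'⟩ := b.exists_radius_planar_one_gt_upperRight T hδ₁ hdisj
  obtain ⟨rA', hrA', hA'⟩ := b.exists_radius_planar_one_gt_upperLeft T hδ₁ hdisj
  obtain ⟨a₁, ha₁, h₁⟩ := b.exists_cornerControl T hrA fun c hc hd hs hne ↦
    let ⟨h1, h2⟩ := hA c hc hd hs hne; ⟨h1, Or.inl h2⟩
  obtain ⟨a₂, ha₂, h₂⟩ := b.exists_cornerControl T hrB fun c hc hd hs hne ↦
    let ⟨h1, h2⟩ := hB c hc hd hs hne; ⟨h1, Or.inl h2⟩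
  obtain ⟨a₃, ha₃, h₃⟩ := b.exists_cornerControl T hrB' fun c hc hd hs hne ↦
    let ⟨h1, h2⟩ := hB' c hc hd hs hne; ⟨h1, Or.inr h2⟩
  obtain ⟨a₄, ha₄, h₄⟩ := b.exists_cornerControl T hrA' fun c hc hd hs hne ↦
    let ⟨h1, h2⟩ := hA' c hc hd hs hne; ⟨h1, Or.inr h2⟩
  refine ⟨min (min a₁ a₂) (min a₃ a₄), by positivity, fun r hr ↦ ⟨h₁ r ?_, h₂ r ?_, h₃ r ?_, h₄ r ?_⟩⟩
  · exact hr.trans ((min_le_left _ _).trans (min_le_left _ _))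
  · exact hr.trans ((min_le_left _ _).trans (min_le_right _ _))
  · exact hr.trans ((min_le_right _ _).trans (min_le_left _ _))
  · exact hr.trans ((min_le_right _ _).trans (min_le_right _ _))

/-- **A parameter in the closure of the moved set, outside the open collar square, over which `K`
passes at height zero, is a corner.** It lies in the compact `C`, hence in a corner ball and
(closed strip) on the corner's edge line; the point `band x₀ ∈ range K` is off the band surface
and near the attaching point, so by the corner control it is the attaching point. [folklore] -/
theorem eq_corner_of_mem_closure (hM : ∀ x ∈ h.movedSet, x ∈ C ∧ (x ∈ lowerHalf b.δ ∨ x ∈ upperHalf b.δ))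
    (hCc : IsCompact C) {r : ℝ} (hr : r ≤ b.δ)
    (hCsub : C ⊆ lowerHalf b.δ ∪ upperHalf b.δ ∪ (ball (pt2 0 (-b.δ)) r ∪ ball (pt2 1 (-b.δ)) r ∪
        ball (pt2 1 (1 + b.δ)) r ∪ ball (pt2 0 (1 + b.δ)) r))
    (hcc : b.CornerControl T (pt2 0 (-b.δ)) r ∧ b.CornerControl T (pt2 1 (-b.δ)) r ∧
      b.CornerControl T (pt2 1 (1 + b.δ)) r ∧ b.CornerControl T (pt2 0 (1 + b.δ)) r)
    (hδ₁ : b.δ < δ₁) {x₀ : 𝔼 2} (hx₀σ : x₀ ∈ range T.param) (hx₀cl : x₀ ∈ closure h.movedSet)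
    (hx₀sq : x₀ ∉ squareNhd b.δ) (hx₀K : b.band x₀ ∈ range K) :
    ∃ corner : 𝔼 2, (corner = pt2 0 (-b.δ) ∨ corner = pt2 1 (-b.δ) ∨ corner = pt2 1 (1 + b.δ) ∨
      corner = pt2 0 (1 + b.δ)) ∧ x₀ = corner := by
  have hMC : h.movedSet ⊆ C := fun x hx ↦ (hM x hx).1
  have hx₀C : x₀ ∈ C := closure_minimal hMC hCc.isClosed hx₀cl
  have hstrip := (b.movedSet_apply_one hM).2 x₀ hx₀cl
  have hnot : b.band x₀ ∉ b.support := by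
    rintro ⟨x', hx', hxe⟩
    have := T.injOn_patch (T.squareNhd_subset (squareNhd_mono hδ₁.le hx')) hx₀σ hxe
    exact hx₀sq (this ▸ hx')
  -- the generic corner argument
  have key : ∀ (a c : ℝ), a ∈ Icc (0 : ℝ) 1 → (c = -b.δ ∨ c = 1 + b.δ) → dist x₀ (pt2 a c) < r →
      b.CornerControl T (pt2 a c) r → x₀ = pt2 a c := by
    intro a c ha hc hdist hctl
    have h1 : x₀ 1 = c := b.apply_one_eq_of_near_corner ha hc hr hdist hx₀sq hstrip
    obtain ⟨rc, -, hC1, hcont⟩ := hctl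
    have hcornerσ : pt2 a c ∈ range T.param := b.closedSquare_subset_range_param T hδ₁ (by
      rw [pt2_mem_closedSquare_iff]
      refine ⟨⟨by linarith [ha.1, b.δ_pos], by linarith [ha.2, b.δ_pos]⟩, ?_⟩
      rcases hc with rfl | rfl
      · exact ⟨le_rfl, by linarith [b.δ_pos]⟩
      · exact ⟨by linarith [b.δ_pos], le_rfl⟩)
    by_contra hne
    have hne' : b.band x₀ ≠ b.band (pt2 a c) := fun h ↦ hne (T.injOn_patch hx₀σ hcornerσ h)
    obtain ⟨-, hlt⟩ := hC1 _ hx₀K (hcont x₀ hdist) hnot hne'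
    rw [T.planar_apply_patch hx₀σ, h1] at hlt
    rcases hc with rfl | rfl <;> rcases hlt with hlt | hlt <;> linarith [b.δ_pos]
  rcases hCsub hx₀C with (hx | hx) | (((hx | hx) | hx) | hx)
  · exact absurd hx.1 hx₀sq
  · exact absurd hx.1 hx₀sq
  · exact ⟨_, Or.inl rfl, key 0 _ (left_mem_Icc.2 zero_le_one) (Or.inl rfl) hx hcc.1⟩
  · exact ⟨_, Or.inr (Or.inl rfl), key 1 _ (right_mem_Icc.2 zero_le_one) (Or.inl rfl) hx hcc.2.1⟩
  · exact ⟨_, Or.inr (Or.inr (Or.inl rfl)), key 1 _ (right_mem_Icc.2 zero_le_one) (Or.inr rfl) hx hcc.2.2.1⟩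
  · exact ⟨_, Or.inr (Or.inr (Or.inr rfl)), key 0 _ (left_mem_Icc.2 zero_le_one) (Or.inr rfl) hx hcc.2.2.2⟩

/-- **Points of `K` off the band surface lie over unmoved parameters, below a uniform height**
(the fixing lemma of the assembly): `FixesOff` for all of `range K`, by compactness from the
pointwise statements at points off the thickening, at nonzero height, over parameters outside the
closure of the moved set, on the open arcs, and at the four attaching points. [folklore] -/
theorem fixesOff_range (hδ₁ : b.δ < δ₁) (hdisj : Disjoint (range K₁) (range K₂))
    (hM : ∀ x ∈ h.movedSet, x ∈ C ∧ (x ∈ lowerHalf b.δ ∨ x ∈ upperHalf b.δ))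
    (hCc : IsCompact C) (hCσ : C ⊆ range T.param) {r : ℝ} (hr : r ≤ b.δ)
    (hCsub : C ⊆ lowerHalf b.δ ∪ upperHalf b.δ ∪ (ball (pt2 0 (-b.δ)) r ∪ ball (pt2 1 (-b.δ)) r ∪
        ball (pt2 1 (1 + b.δ)) r ∪ ball (pt2 0 (1 + b.δ)) r))
    (hcc : b.CornerControl T (pt2 0 (-b.δ)) r ∧ b.CornerControl T (pt2 1 (-b.δ)) r ∧
      b.CornerControl T (pt2 1 (1 + b.δ)) r ∧ b.CornerControl T (pt2 0 (1 + b.δ)) r) :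
    b.FixesOff T h (range K) := by
  have hMC : h.movedSet ⊆ C := fun x hx ↦ (hM x hx).1
  refine (isCompact_range K.continuous).induction_on (p := fun S ↦ b.FixesOff T h S)
    (b.fixesOff_empty T h) (fun S S' hSS' hS' ↦ b.fixesOff_mono T h hSS' hS')
    (fun S S' hS hS' ↦ b.fixesOff_union T h hS hS') ?_
  intro c hcK
  suffices hU : ∃ U ∈ 𝓝 c, b.FixesOff T h U by
    obtain ⟨U, hU, hfix⟩ := hU
    exact ⟨U, mem_nhdsWithin_of_mem_nhds hU, hfix⟩
  by_cases hce : c ∈ range T.emb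
  · obtain ⟨v, rfl⟩ := hce
    obtain ⟨⟨y₀, z₀⟩, rfl⟩ : ∃ q : (𝔼 2) × 𝔼 1, slabEquiv.symm q = v :=
      ⟨slabEquiv v, slabEquiv.symm_apply_apply v⟩
    by_cases hz : z₀ = 0
    · subst hz
      by_cases hcl : T.param y₀ ∈ closure h.movedSet
      · by_cases hsq : T.param y₀ ∈ squareNhd b.δ
        · -- on an open arc
          have hcs : T.emb (slabEquiv.symm (y₀, 0)) ∈ b.support := by
            rw [T.emb_inl]; exact ⟨_, hsq, rfl⟩
          rcases b.mem_arcs_of_mem_support hcK hcs with ⟨s, hs, hse⟩ | ⟨s, hs, hse⟩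
          · rw [← hse]; exact b.fixesOff_nhds_of_mem_lowerCurve T hδ₁ hs
          · rw [← hse]; exact b.fixesOff_nhds_of_mem_upperCurve T hδ₁ hdisj hs
        · -- at an attaching point
          have hK' : b.band (T.param y₀) ∈ range K := by rw [← T.emb_inl]; exact hcK
          obtain ⟨corner, hcorner, hy₀⟩ := b.eq_corner_of_mem_closure T hM hCc hr hCsub hcc hδ₁
            ⟨y₀, rfl⟩ hcl hsq hK'
          rw [T.emb_inl, hy₀]
          have hcornerσ : corner ∈ range T.param := hy₀ ▸ ⟨y₀, rfl⟩
          rcases hcorner with rfl | rfl | rfl | rfl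
          · obtain ⟨rc, hrc, hC1, -⟩ := hcc.1
            exact b.fixesOff_nhds_corner T hM hcornerσ (Or.inl (pt2_apply_one _ _)) hrc hC1
          · obtain ⟨rc, hrc, hC1, -⟩ := hcc.2.1
            exact b.fixesOff_nhds_corner T hM hcornerσ (Or.inl (pt2_apply_one _ _)) hrc hC1
          · obtain ⟨rc, hrc, hC1, -⟩ := hcc.2.2.1
            exact b.fixesOff_nhds_corner T hM hcornerσ (Or.inr (pt2_apply_one _ _)) hrc hC1
          · obtain ⟨rc, hrc, hC1, -⟩ := hcc.2.2.2
            exact b.fixesOff_nhds_corner T hM hcornerσ (Or.inr (pt2_apply_one _ _)) hrc hC1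
      · exact b.fixesOff_nhds_of_not_mem_closure T hcl 0
    · exact b.fixesOff_nhds_of_height_ne T hz
  · exact b.fixesOff_nhds_of_not_mem_range T hMC hCc hCσ hce

/-! ### The image of the open arcs under the final planar stage -/

/-- The corners are never moved. [folklore] -/
theorem corner_not_mem_movedSet (hM : ∀ x ∈ h.movedSet, x ∈ C ∧ (x ∈ lowerHalf b.δ ∨ x ∈ upperHalf b.δ))
    (a : ℝ) {c : ℝ} (hc : c = -b.δ ∨ c = 1 + b.δ) : pt2 a c ∉ h.movedSet := by
  intro hm
  have h1 := ((b.movedSet_apply_one hM).1 _ hm) 1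
  rw [pt2_apply_one] at h1
  rcases hc with rfl | rfl
  · exact lt_irrefl _ h1.1
  · exact lt_irrefl _ h1.2

/-- The final planar stage carries the open lower arc of `b` onto that of `b'`. [folklore] -/
theorem image_lowerArc_Ioo (b' : BandData K₁ K₂ K' avoid') (hδ : b'.δ = b.δ)
    (hM : ∀ x ∈ h.movedSet, x ∈ C ∧ (x ∈ lowerHalf b.δ ∨ x ∈ upperHalf b.δ))
    (himg : h.toFun 1 '' (b.lowerArc '' Icc 0 1) = b'.lowerArc '' Icc 0 1) :
    h.toFun 1 '' (b.lowerArc '' Ioo 0 1) = b'.lowerArc '' Ioo 0 1 := by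
  have hA : h.toFun 1 (pt2 0 (-b.δ)) = pt2 0 (-b.δ) :=
    h.toFun_eq_self_of_not_mem_movedSet (b.corner_not_mem_movedSet hM 0 (Or.inl rfl)) 1
  have hB : h.toFun 1 (pt2 1 (-b.δ)) = pt2 1 (-b.δ) :=
    h.toFun_eq_self_of_not_mem_movedSet (b.corner_not_mem_movedSet hM 1 (Or.inl rfl)) 1
  rw [b.lowerArc_image_Ioo, b'.lowerArc_image_Ioo, hδ,
    image_diff_pair_of_apply_eq (f := h.toFun 1) (h.stage 1).injective hA hB, himg]

/-- The final planar stage carries the open upper arc of `b` onto that of `b'`. [folklore] -/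
theorem image_upperArc_Ioo (b' : BandData K₁ K₂ K' avoid') (hδ : b'.δ = b.δ)
    (hM : ∀ x ∈ h.movedSet, x ∈ C ∧ (x ∈ lowerHalf b.δ ∨ x ∈ upperHalf b.δ))
    (himg : h.toFun 1 '' (b.upperArc '' Icc 0 1) = b'.upperArc '' Icc 0 1) :
    h.toFun 1 '' (b.upperArc '' Ioo 0 1) = b'.upperArc '' Ioo 0 1 := by
  have hA : h.toFun 1 (pt2 1 (1 + b.δ)) = pt2 1 (1 + b.δ) :=
    h.toFun_eq_self_of_not_mem_movedSet (b.corner_not_mem_movedSet hM 1 (Or.inr rfl)) 1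
  have hB : h.toFun 1 (pt2 0 (1 + b.δ)) = pt2 0 (1 + b.δ) :=
    h.toFun_eq_self_of_not_mem_movedSet (b.corner_not_mem_movedSet hM 0 (Or.inr rfl)) 1
  rw [b.upperArc_image_Ioo, b'.upperArc_image_Ioo, hδ,
    image_diff_pair_of_apply_eq (f := h.toFun 1) (h.stage 1).injective hA hB, himg]

/-! ### The orientation clause at the attaching point `p` -/

/-- **Orientation at `p`**: if a smooth self-map `G` of `𝕊³` fixes `p = band (0, -δ)` and every
point of `K` off the band surface, then `G ∘ K` and `K'` induce the same orientation, for band-sum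
data `b`, `b'` with the same band and collar (band injective on the closed collar, summands
disjoint). Just before `p` the knot `K` runs off the band surface (on `K₁`), so `G ∘ K ∘ circlePoint`
agrees with `K ∘ circlePoint` on a left neighbourhood of the parameter of `p`, hence has the same
velocity there; and by junction analysis I the velocities of `K` and of `K'` at `p` are both
positive multiples of the velocity of `K₁` at `p`. [folklore] -/
theorem sameOrientationAt_of_fix (b' : BandData K₁ K₂ K' avoid') (hband : b'.band = b.band) (hδ : b'.δ = b.δ)
    (hcl : InjOn b.band (closedSquare b.δ)) (hdisj : Disjoint (range K₁) (range K₂))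
    {G : 𝕊 3 → 𝕊 3} (hG : ContMDiff (𝓡 3) (𝓡 3) ∞ G) (hGp : G (b.band (pt2 0 (-b.δ))) = b.band (pt2 0 (-b.δ)))
    (hGfix : ∀ c ∈ range K, c ∉ b.support → G c = c) : Knot.SameOrientationAt (G ∘ K) K' := by
  haveI := Fact.mk (@finrank_euclideanSpace_fin ℝ _ (3 + 1))
  obtain ⟨φ, hφ, hφm, hφℓ⟩ := b.exists_lift_lowerCurve
  obtain ⟨φ', hφ', hφ'm, hφ'ℓ⟩ := b'.exists_lift_lowerCurve
  obtain ⟨χ, hχ, hχm, hχe⟩ := b.exists_lift_leftEdge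
  have hcl' : InjOn b'.band (closedSquare b'.δ) := by rw [hband, hδ]; exact hcl
  have hχe' : ∀ s ∈ Icc (0 : ℝ) 1, K₁ (circlePt (χ s)) = b'.leftEdge s := by
    rw [b.leftEdge_eq_of_band_eq b' hband hδ]; exact hχe
  obtain ⟨μ, hμ, hv⟩ := b.exists_pos_deriv_curve_eq_smul_left hcl hdisj hφ hφm hφℓ hχ hχm hχe
  obtain ⟨μ', hμ', hv'⟩ := b'.exists_pos_deriv_curve_eq_smul_left hcl' hdisj hφ' hφ'm hφ'ℓ hχ hχm hχe'
  have hp : K (circlePt (φ 0)) = b.band (pt2 0 (-b.δ)) := by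
    rw [hφℓ 0 (left_mem_Icc.2 zero_le_one), lowerCurve_zero]
  have hp' : K' (circlePt (φ' 0)) = b.band (pt2 0 (-b.δ)) := by
    rw [hφ'ℓ 0 (left_mem_Icc.2 zero_le_one), lowerCurve_zero, hband, hδ]
  set θ₀ : ℝ := 2 * π * φ 0 with hθ₀
  set θ₀' : ℝ := 2 * π * φ' 0 with hθ₀'
  have hπ : (0 : ℝ) < 2 * π := by positivity
  have hm : ∀ θ, circlePoint θ = circlePt ((2 * π)⁻¹ * θ) := fun θ ↦ by
    rw [circlePt_eq_circlePoint, mul_inv_cancel_left₀ hπ.ne']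
  have hmθ₀ : (2 * π)⁻¹ * θ₀ = φ 0 := by rw [hθ₀, inv_mul_cancel_left₀ hπ.ne']
  have hmθ₀' : (2 * π)⁻¹ * θ₀' = φ' 0 := by rw [hθ₀', inv_mul_cancel_left₀ hπ.ne']
  -- agreement of `G ∘ K` and `K` just before `p`
  have hev := b.eventually_apply_circlePt_mem_left hcl hdisj hφ hφm hφℓ
  have htend : Tendsto (fun θ : ℝ ↦ (2 * π)⁻¹ * θ) (𝓝[<] θ₀) (𝓝[<] (φ 0)) := by
    refine tendsto_nhdsWithin_of_tendsto_nhds_of_eventually_within _ ?_ ?_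
    · rw [← hmθ₀]; exact ((continuous_const.mul continuous_id).tendsto θ₀).mono_left nhdsWithin_le_nhds
    · filter_upwards [self_mem_nhdsWithin] with θ hθ
      rw [← hmθ₀]; exact mul_lt_mul_of_pos_left (mem_Iio.1 hθ) (by positivity)
  have hagree : ∀ᶠ θ in 𝓝[≤] θ₀,
      ((G (K (circlePoint θ)) : 𝕊 3) : 𝔼 4) = ((K (circlePoint θ) : 𝕊 3) : 𝔼 4) := by
    rw [← Iio_insert, nhdsWithin_insert, eventually_sup]
    constructor
    · rw [eventually_pure, hm θ₀, hmθ₀, hp, hGp]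
    · filter_upwards [htend.eventually hev] with θ hθ
      rw [hm θ, hGfix _ (mem_range_self _) hθ.2]
  -- differentiability of both tracks
  have hdiffK : ∀ (L : Knot) (θ : ℝ),
      DifferentiableAt ℝ (fun t ↦ ((L (circlePoint t) : 𝕊 3) : 𝔼 4)) θ := fun L θ ↦ by
    rw [L.coe_apply_circlePoint_eq]
    exact ((L.contDiff_curve.differentiable (by simp)).comp (differentiable_id.const_mul ((2 * π)⁻¹))) θ
  have hdiffG : DifferentiableAt ℝ (fun t ↦ ((G (K (circlePoint t)) : 𝕊 3) : 𝔼 4)) θ₀ := by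
    have h1 : ContMDiff 𝓘(ℝ, ℝ) 𝓘(ℝ, 𝔼 4) ∞ (fun t ↦ ((G (K (circlePoint t)) : 𝕊 3) : 𝔼 4)) :=
      (contMDiff_coe_sphere (m := ∞)).comp (hG.comp (K.contMDiff.comp contMDiff_circlePoint))
    exact (contMDiff_iff_contDiff.1 h1).differentiable (by simp) θ₀
  have hderiv := deriv_eq_of_eventuallyEq_nhdsLE hdiffG (hdiffK K θ₀) hagree
  refine ⟨θ₀, θ₀', μ / μ', div_pos hμ hμ', ?_, ?_⟩
  · show G (K (circlePoint θ₀)) = K' (circlePoint θ₀')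
    rw [hm θ₀, hmθ₀, hp, hGp, hm θ₀', hmθ₀', hp']
  · show deriv (fun t ↦ ((G (K (circlePoint t)) : 𝕊 3) : 𝔼 4)) θ₀ =
      (μ / μ') • deriv (fun t ↦ ((K' (circlePoint t) : 𝕊 3) : 𝔼 4)) θ₀'
    rw [hderiv, K.deriv_coe_apply_circlePoint, K'.deriv_coe_apply_circlePoint, hmθ₀, hmθ₀', hv, hv',
      smul_smul, smul_smul, smul_smul]
    congr 1
    field_simp

/-! ### The ambient isotopy -/

/-- Balls of radius `r` about the corners lie in the wider collar square when `δ + r < δ₁`.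
[folklore] -/
theorem ball_corner_subset_squareNhd {a c r δ₁ : ℝ} (ha : a ∈ Icc (0 : ℝ) 1) (hc : c = -b.δ ∨ c = 1 + b.δ)
    (hr : b.δ + r < δ₁) {x : 𝔼 2} (hx : dist x (pt2 a c) < r) : x ∈ squareNhd δ₁ := by
  have hδ := b.δ_pos
  have h0 : |x 0 - a| < r := by
    have := PiLp.dist_apply_le x (pt2 a c) 0
    rw [pt2_apply_zero, Real.dist_eq] at this
    exact lt_of_le_of_lt this hx
  have h1 : |x 1 - c| < r := by
    have := PiLp.dist_apply_le x (pt2 a c) 1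
    rw [pt2_apply_one, Real.dist_eq] at this
    exact lt_of_le_of_lt this hx
  rw [abs_lt] at h0 h1
  intro i
  fin_cases i
  · show x 0 ∈ Ioo (-δ₁) (1 + δ₁)
    exact ⟨by linarith [ha.1], by linarith [ha.2]⟩
  · show x 1 ∈ Ioo (-δ₁) (1 + δ₁)
    rcases hc with rfl | rfl
    · exact ⟨by linarith, by linarith⟩
    · exact ⟨by linarith, by linarith⟩

end BandData

/-! ## Discharge by the lifted-arc construction

No planar isotopy of the arc systems is needed for the corrected facts: the two arc windows of
`K` are moved onto those of `K'` through **embedded space arcs in the thickened band**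
(`BandSumWindowFamily.lean`: in slab coordinates the straight-line homotopy of the planar arcs,
lifted by a height which is strictly monotone in the parameter on the middle of the window,
`LiftedArcFamily.lean`), the windows of `K'` being re-parametrised over those of `K` by
`BandSumArcMatching.lean`; the resulting smooth family of modifications of `K` is covered by an
ambient isotopy stationary off `V` by the isotopy extension theorem relative to a closed set
(`KnotFamilyAmbientIsotopy.lean`, `IsotopyExtensionRel.lean`). This section assembles these into
`BandData.exists_ambientIsotopy_of_band_eq_of_isRegular_holds` and
`BandData.isIsotopic_of_band_eq_of_isRegular_holds`.
-/

attribute [local instance] fact_finrank_euclideanSpace_two fact_finrank_euclideanSpace_four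

/-! ## The lifted-arc assembly: discharge of `exists_ambientIsotopy_of_band_eq_of_isRegular` -/

section LiftAssembly

/-- The closed collar square is contained in the closure of the open collar square (`δ > 0`): every
point of it is the limit of points of the open segment joining it to the centre. [folklore] -/
theorem closedSquare_subset_closure_squareNhd {δ : ℝ} (hδ : 0 < δ) : closedSquare δ ⊆ closure (squareNhd δ) := by
  intro x hx
  have hseg : ∀ s ∈ Ioc (0 : ℝ) 1, (1 - s) • x + s • (pt2 2⁻¹ 2⁻¹ : 𝔼 2) ∈ squareNhd δ := by
    intro s hs i
    have hxi := hx i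
    have hm : (![2⁻¹, 2⁻¹] : Fin 2 → ℝ) i = 2⁻¹ := by fin_cases i <;> rfl
    simp only [PiLp.add_apply, PiLp.smul_apply, smul_eq_mul]
    show (1 - s) * x i + s * (![2⁻¹, 2⁻¹] : Fin 2 → ℝ) i ∈ Ioo (-δ) (1 + δ)
    rw [hm]
    constructor <;> nlinarith [hxi.1, hxi.2, hs.1, hs.2]
  have hcont : Tendsto (fun s : ℝ ↦ (1 - s) • x + s • (pt2 2⁻¹ 2⁻¹ : 𝔼 2)) (𝓝[>] 0) (𝓝 x) := by
    have : Continuous fun s : ℝ ↦ (1 - s) • x + s • (pt2 2⁻¹ 2⁻¹ : 𝔼 2) := by fun_prop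
    have h0 := this.tendsto 0
    simp only [sub_zero, one_smul, zero_smul, add_zero] at h0
    exact h0.mono_left nhdsWithin_le_nhds
  refine mem_closure_of_tendsto hcont ?_
  filter_upwards [Ioc_mem_nhdsGT zero_lt_one] with s hs using hseg s hs

open Classical in
/-- **The two-window family**: `F₁` on the strip `I₁`, `F₂` on the strip `I₂`, the curve of `K`
elsewhere. [folklore] -/
def twoWindowFam (K : Knot) (F₁ F₂ : ℝ → ℝ → 𝔼 4) (I₁ I₂ : Set ℝ) (u t : ℝ) : 𝔼 4 :=
  if t ∈ I₁ then F₁ u t else if t ∈ I₂ then F₂ u t else Knot.curve K t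

section TwoWindow

variable {K : Knot} {F₁ F₂ : ℝ → ℝ → 𝔼 4} {I₁ I₂ C₁ C₂ : Set ℝ}

/-- The two-window family on the first strip. [folklore] -/
theorem twoWindowFam_of_mem_left (u : ℝ) {t : ℝ} (ht : t ∈ I₁) : twoWindowFam K F₁ F₂ I₁ I₂ u t = F₁ u t := by
  simp [twoWindowFam, ht]

/-- The two-window family on the second strip. [folklore] -/
theorem twoWindowFam_of_mem_right (hdisj : Disjoint I₁ I₂) (u : ℝ) {t : ℝ} (ht : t ∈ I₂) :
    twoWindowFam K F₁ F₂ I₁ I₂ u t = F₂ u t := by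
  have h1 : t ∉ I₁ := fun h ↦ Set.disjoint_left.1 hdisj h ht
  simp [twoWindowFam, ht, h1]

/-- The two-window family off both strips. [folklore] -/
theorem twoWindowFam_of_not_mem (u : ℝ) {t : ℝ} (h1 : t ∉ I₁) (h2 : t ∉ I₂) :
    twoWindowFam K F₁ F₂ I₁ I₂ u t = Knot.curve K t := by
  simp [twoWindowFam, h1, h2]

/-- The two-window family agrees with the curve of `K` off the closed windows, if each piece does
on its strip. [folklore] -/
theorem twoWindowFam_eq_curve (hdisj : Disjoint I₁ I₂) (h₁ : ∀ u t, t ∈ I₁ → t ∉ C₁ → F₁ u t = Knot.curve K t)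
    (h₂ : ∀ u t, t ∈ I₂ → t ∉ C₂ → F₂ u t = Knot.curve K t) (u : ℝ) {t : ℝ} (ht₁ : t ∉ C₁) (ht₂ : t ∉ C₂) :
    twoWindowFam K F₁ F₂ I₁ I₂ u t = Knot.curve K t := by
  by_cases hI₁ : t ∈ I₁
  · rw [twoWindowFam_of_mem_left u hI₁, h₁ u t hI₁ ht₁]
  by_cases hI₂ : t ∈ I₂
  · rw [twoWindowFam_of_mem_right hdisj u hI₂, h₂ u t hI₂ ht₂]
  · exact twoWindowFam_of_not_mem u hI₁ hI₂

/-- **Smoothness of the two-window family**: the strips are open and disjoint, the windows closed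
inside them, each piece is jointly smooth over its strip and agrees with the curve of `K` on the
strip off its window. [folklore] -/
theorem contDiff_twoWindowFam (hI₁ : IsOpen I₁) (hI₂ : IsOpen I₂) (hdisj : Disjoint I₁ I₂)
    (hC₁ : IsClosed C₁) (hC₂ : IsClosed C₂) (hCI₁ : C₁ ⊆ I₁) (hCI₂ : C₂ ⊆ I₂)
    (hs₁ : ∀ p : ℝ × ℝ, p.2 ∈ I₁ → ContDiffAt ℝ ∞ (uncurry F₁) p)
    (hs₂ : ∀ p : ℝ × ℝ, p.2 ∈ I₂ → ContDiffAt ℝ ∞ (uncurry F₂) p)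
    (h₁ : ∀ u t, t ∈ I₁ → t ∉ C₁ → F₁ u t = Knot.curve K t)
    (h₂ : ∀ u t, t ∈ I₂ → t ∉ C₂ → F₂ u t = Knot.curve K t) :
    ContDiff ℝ ∞ (uncurry (twoWindowFam K F₁ F₂ I₁ I₂)) := by
  rw [contDiff_iff_contDiffAt]
  rintro ⟨u, t⟩
  by_cases ht₁ : t ∈ I₁
  · have hev : uncurry (twoWindowFam K F₁ F₂ I₁ I₂) =ᶠ[𝓝 (u, t)] uncurry F₁ := by
      have : (univ : Set ℝ) ×ˢ I₁ ∈ 𝓝 (u, t) := prod_mem_nhds univ_mem (hI₁.mem_nhds ht₁)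
      filter_upwards [this] with q hq using twoWindowFam_of_mem_left q.1 hq.2
    exact (hs₁ _ ht₁).congr_of_eventuallyEq hev
  by_cases ht₂ : t ∈ I₂
  · have hev : uncurry (twoWindowFam K F₁ F₂ I₁ I₂) =ᶠ[𝓝 (u, t)] uncurry F₂ := by
      have : (univ : Set ℝ) ×ˢ I₂ ∈ 𝓝 (u, t) := prod_mem_nhds univ_mem (hI₂.mem_nhds ht₂)
      filter_upwards [this] with q hq using twoWindowFam_of_mem_right hdisj q.1 hq.2
    exact (hs₂ _ ht₂).congr_of_eventuallyEq hev
  · have htC : t ∉ C₁ ∪ C₂ := fun h ↦ h.elim (fun h ↦ ht₁ (hCI₁ h)) (fun h ↦ ht₂ (hCI₂ h))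
    have hev : uncurry (twoWindowFam K F₁ F₂ I₁ I₂) =ᶠ[𝓝 (u, t)] fun q : ℝ × ℝ ↦ Knot.curve K q.2 := by
      have : (univ : Set ℝ) ×ˢ (C₁ ∪ C₂)ᶜ ∈ 𝓝 (u, t) :=
        prod_mem_nhds univ_mem ((hC₁.union hC₂).isOpen_compl.mem_nhds htC)
      filter_upwards [this] with q hq
      have hq' : q.2 ∉ C₁ ∧ q.2 ∉ C₂ := by
        have := hq.2; rw [mem_compl_iff, mem_union, not_or] at this; exact this
      exact twoWindowFam_eq_curve hdisj h₁ h₂ q.1 hq'.1 hq'.2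
    exact (K.contDiff_curve.contDiffAt.comp _ contDiffAt_snd).congr_of_eventuallyEq hev

end TwoWindow

namespace BandData

variable {K₁ K₂ K K' : Knot} {avoid avoid' : Set (𝕊 3)} (b : BandData K₁ K₂ K avoid)

/-- The band maps the closed collar square into every neighbourhood of the closure of the band
surface. [folklore] -/
theorem band_mem_of_mem_closedSquare {V : Set (𝕊 3)} (hVsub : closure b.support ⊆ V) {x : 𝔼 2}
    (hx : x ∈ closedSquare b.δ) : b.band x ∈ V :=
  hVsub (image_closure_subset_closure_image b.contMDiff.continuous
    ⟨x, closedSquare_subset_closure_squareNhd b.δ_pos hx, rfl⟩)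

/-- A corner of the collar square is not mapped into the (open) band surface, for a band injective
on the closed collar. [folklore] -/
theorem band_corner_not_mem_support (hcl : InjOn b.band (closedSquare b.δ)) {a c : ℝ} (ha : a = 0 ∨ a = 1)
    (hc : c = -b.δ ∨ c = 1 + b.δ) : b.band (pt2 a c) ∉ b.support := by
  rintro ⟨x, hx, hxe⟩
  have h := hcl (squareNhd_subset_closedSquare _ hx) (b.corner_mem_closedSquare ha hc) hxe
  have h1 := (hx 1)
  rw [h, pt2_apply_one] at h1
  rcases hc with rfl | rfl
  · exact lt_irrefl _ h1.1
  · exact lt_irrefl _ h1.2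

/-- **The upper window can be placed between the lower window and its translate.** For a lift `φ`
of the closed lower arc there is a lift `ψ` of the closed lower arc of the half-turned data (i.e. of
the closed upper arc of `b`) with `φ 1 < ψ 0` and `ψ 1 < φ 0 + 1`: shift any lift by an integer into
`(φ 1, φ 1 + 1]`; the end value `φ 1 + 1`, windows containing `φ 0 + 1`, and windows starting beyond
it are excluded because the attaching points are distinct corners and the closed arcs are disjoint.
[folklore] -/
theorem exists_isLowerLift_halfTurn {δ₀ δ₁ : ℝ} (T : PatchThickening b.band δ₀ δ₁) (hδ₁ : b.δ < δ₁)
    (hdisj : Disjoint (range K₁) (range K₂)) {φ : ℝ → ℝ} (hφ : b.IsLowerLift φ) :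
    ∃ ψ : ℝ → ℝ, (b.halfTurn hdisj).IsLowerLift ψ ∧ φ 1 < ψ 0 ∧ ψ 1 < φ 0 + 1 := by
  have hδ := b.δ_pos
  have hcl : InjOn b.band (closedSquare b.δ) := b.injOn_band_closedSquare T hδ₁
  have hclR : InjOn (b.halfTurn hdisj).band (closedSquare (b.halfTurn hdisj).δ) :=
    (b.halfTurn hdisj).injOn_band_closedSquare T.halfTurn hδ₁
  obtain ⟨ψ₀, hψ₀⟩ := (b.halfTurn hdisj).exists_isLowerLift
  set m : ℤ := ⌊φ 1 + 1 - ψ₀ 0⌋ with hm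
  have hψl : (b.halfTurn hdisj).IsLowerLift fun s ↦ ψ₀ s + m := hψ₀.add_int m
  have h01 := hφ.zero_lt_one
  have h1 := hφ.one_lt hcl
  have hψ01 := hψl.zero_lt_one
  have hψ1 := hψl.one_lt hclR
  have hfl₁ := Int.floor_le (φ 1 + 1 - ψ₀ 0)
  have hfl₂ := Int.lt_floor_add_one (φ 1 + 1 - ψ₀ 0)
  have hlo : φ 1 < ψ₀ 0 + m := by rw [hm]; linarith
  have hhi : ψ₀ 0 + m ≤ φ 1 + 1 := by rw [hm]; linarith
  -- the attaching point of the upper arc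
  have hq' : K (circlePt (ψ₀ 0 + m)) = b.band (pt2 1 (1 + b.δ)) := by
    have := hψl.apply_zero
    simp only [halfTurn_band, halfTurn_δ, pt2_one_one_sub_pt2] at this
    rw [this]; norm_num
  -- (i) the shifted window does not start at `φ 1 + 1`
  have hne : ψ₀ 0 + m ≠ φ 1 + 1 := by
    intro h
    have h2 : K (circlePt (ψ₀ 0 + m)) = b.band (pt2 1 (-b.δ)) := by
      rw [h, show φ 1 + 1 = φ 1 + ((1 : ℤ) : ℝ) by push_cast; ring, circlePt_add_int, hφ.apply_one]
    rw [hq'] at h2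
    have h3 := hcl (b.corner_mem_closedSquare (Or.inr rfl) (Or.inr rfl)) (b.corner_mem_closedSquare (Or.inr rfl) (Or.inl rfl)) h2
    have h4 : (pt2 1 (1 + b.δ) : 𝔼 2) 1 = (pt2 1 (-b.δ) : 𝔼 2) 1 := by rw [h3]
    rw [pt2_apply_one, pt2_apply_one] at h4
    linarith
  have hhi' : ψ₀ 0 + m < φ 1 + 1 := lt_of_le_of_ne hhi hne
  refine ⟨fun s ↦ ψ₀ s + m, hψl, hlo, ?_⟩
  -- (ii) the shifted window ends before `φ 0 + 1`
  by_contra hcon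
  push Not at hcon
  by_cases hcase : ψ₀ 0 + m ≤ φ 0 + 1
  · -- `φ 0 + 1` lies in the upper window: `p` would be on the closed upper arc
    obtain ⟨s, hs, hse⟩ := hψl.exists_eq_of_mem (t := φ 0 + 1) ⟨hcase, hcon⟩
    have h2 : K (circlePt (φ 0 + 1)) = b.band (pt2 0 (-b.δ)) := by
      rw [show φ 0 + 1 = φ 0 + ((1 : ℤ) : ℝ) by push_cast; ring, circlePt_add_int, hφ.apply_zero]
    have h3 := hψl.apply_eq hs
    rw [hse, h2, halfTurn_lowerCurve] at h3
    exact b.band_lowerLeft_not_mem_upperCurve hcl ⟨s, hs, h3.symm⟩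
  · -- the upper window starts beyond `φ 0 + 1`: `q'` would be on the open lower arc
    push Not at hcase
    have hmem : ψ₀ 0 + m - 1 ∈ Ioo (φ 0) (φ 1) := ⟨by linarith, by linarith⟩
    have h2 := b.apply_circlePt_mem_lowerCurve_image hφ.continuous hφ.strictMonoOn hφ.2.2 hmem
    rw [show ψ₀ 0 + m - 1 = ψ₀ 0 + m + ((-1 : ℤ) : ℝ) by push_cast; ring, circlePt_add_int, hq'] at h2
    obtain ⟨s, hs, hse⟩ := h2
    exact b.band_corner_not_mem_support hcl (Or.inr rfl) (Or.inr rfl) ⟨b.lowerArc s, (b.lowerArc_mem s hs).1, hse⟩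

/-- The closed collar square is symmetric under the half-turn. [folklore] -/
theorem _root_.Literature.Topology.FourManifolds.pt2_one_one_sub_mem_closedSquare_iff {δ : ℝ} {x : 𝔼 2} :
    pt2 1 1 - x ∈ closedSquare δ ↔ x ∈ closedSquare δ := by
  simp only [closedSquare, mem_setOf_eq, pt2_one_one_sub_apply, mem_Icc]
  constructor <;> intro h i <;> have := h i <;> constructor <;> linarith [this.1, this.2]

/-- Every point of `K` is `K (circlePt t)` for a parameter in a prescribed fundamental domain
`[a, a + 1)`. [folklore] -/
theorem _root_.Literature.Topology.FourManifolds.Knot.exists_mem_Ico_apply_circlePt_eq (K : Knot) (a : ℝ)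
    {x : 𝕊 3} (hx : x ∈ range K) : ∃ t ∈ Ico a (a + 1), K (circlePt t) = x := by
  obtain ⟨z, rfl⟩ := hx
  obtain ⟨n, hn⟩ := exists_toIcoMod_one_eq a (angA z)
  refine ⟨toIcoMod zero_lt_one a (angA z), toIcoMod_one_mem a _, ?_⟩
  rw [hn, show angA z - (n : ℝ) = angA z + ((-n : ℤ) : ℝ) by push_cast; ring, circlePt_add_int, circlePt_angA]

/-- A parameter of a fundamental domain mapping into the open arc lifted by `φ` (window inside the
domain) lies in the open window. [folklore] -/
theorem mem_Ioo_of_apply_mem_lowerCurve_image {φ : ℝ → ℝ} (hφ : b.IsLowerLift φ) {a t : ℝ}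
    (ha : a ≤ φ 0) (ha' : φ 1 ≤ a + 1) (ht : t ∈ Ico a (a + 1))
    (hmem : K (circlePt t) ∈ b.lowerCurve '' Ioo 0 1) : t ∈ Ioo (φ 0) (φ 1) := by
  obtain ⟨s, hs, hse⟩ := hmem
  rw [← hφ.apply_eq (Ioo_subset_Icc_self hs), K.apply_circlePt_eq_iff] at hse
  obtain ⟨m, hm⟩ := hse
  have h0 : φ 0 < φ s := hφ.strictMonoOn (left_mem_Icc.2 zero_le_one) (Ioo_subset_Icc_self hs) hs.1
  have h1 : φ s < φ 1 := hφ.strictMonoOn (Ioo_subset_Icc_self hs) (right_mem_Icc.2 zero_le_one) hs.2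
  have hlt : (-1 : ℝ) < m := by linarith [ht.2]
  have hgt : (m : ℝ) < 1 := by linarith [ht.1]
  have h1' : (-1 : ℤ) < m := by exact_mod_cast hlt
  have h2' : m < (1 : ℤ) := by exact_mod_cast hgt
  obtain rfl : m = 0 := by omega
  simp only [Int.cast_zero, add_zero] at hm
  rw [← hm]; exact ⟨h0, h1⟩

/-- **The corrected geometric heart, by the lifted-arc construction** (for one pair of band-sum
data): regular band-sum data `b`, `b'` with the same band and collar and disjoint summands have
results with ambient isotopic oriented images, by an ambient isotopy stationary off any
neighbourhood `V` of the closure of the band surface. Assembly: thicken the band (`T`); lift the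
two arc windows of `K` (`φ` lower, `ψ` upper = lower window of the half-turned data, placed in one
period); match the windows of `K'` over them (`WindowMatching`); move each window through embedded
space arcs in the thickened band (`WindowMatching.fam`, good parameters from `exists_good` with the
tube of `V`); the two-window family is a smooth family of modifications of `K`
(`Knot.IsModification`), covered by an ambient isotopy stationary off `V`
(`Knot.IsModification.exists_ambientIsotopy`, isotopy extension); its end carries `range K` onto
`range K'`, and the orientation clause holds at `p` (`sameOrientationAt_of_fix`). [folklore] -/
theorem exists_ambientIsotopy_of_isRegular_lift (b' : BandData K₁ K₂ K' avoid') (hreg : b.IsRegular)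
    (hdisj : Disjoint (range K₁) (range K₂)) (hband : b.band = b'.band) (hδ : b.δ = b'.δ)
    (V : Set (𝕊 3)) (hV : IsOpen V) (hVsub : closure b.support ⊆ V) :
    ∃ F : AmbientIsotopy (𝓡 3) (𝕊 3), (∀ t, ∀ x ∉ V, F.toFun t x = x) ∧
      F.toFun 1 '' range K = range K' ∧ Knot.SameOrientationAt (F.toFun 1 ∘ K) K' := by
  have hδpos := b.δ_pos
  obtain ⟨δ₀, δ₁, hδ₁, -, ⟨T⟩⟩ := hreg.exists_patchThickening
  have hcl : InjOn b.band (closedSquare b.δ) := b.injOn_band_closedSquare T hδ₁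
  -- the tube inside `V`
  obtain ⟨z₁, hz₁, hVtube⟩ := b.exists_tube_subset T (isCompact_closedSquare b.δ)
    (b.closedSquare_subset_range_param T hδ₁) hV (fun x hx ↦ b.band_mem_of_mem_closedSquare hVsub hx)
  -- lifts of the four windows
  obtain ⟨φ, hφ⟩ := b.exists_isLowerLift
  obtain ⟨φ', hφ'⟩ := b'.exists_isLowerLift
  obtain ⟨ψ, hψ, hψ0, hψ1⟩ := b.exists_isLowerLift_halfTurn T hδ₁ hdisj hφ
  obtain ⟨ψ', hψ'⟩ := (b'.halfTurn hdisj).exists_isLowerLift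
  have hbandR : (b'.halfTurn hdisj).band = (b.halfTurn hdisj).band := by
    funext x
    show b'.band (pt2 1 1 - x) = b.band (pt2 1 1 - x)
    rw [hband]
  have hδR : (b'.halfTurn hdisj).δ = (b.halfTurn hdisj).δ := hδ.symm
  obtain ⟨W⟩ := nonempty_windowMatching b b' T hδ₁ hdisj hband.symm hδ.symm hφ hφ'
  obtain ⟨WR⟩ := nonempty_windowMatching (b.halfTurn hdisj) (b'.halfTurn hdisj) T.halfTurn hδ₁ hdisj.symm hbandR hδR
    hψ hψ'
  -- good parameters
  obtain ⟨κ, c, hκ, -, hinj, hder, havoid, hloc⟩ := W.exists_good hz₁ hVtube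
  have hVtubeR : ∀ (y : 𝔼 2) (h : 𝔼 1), T.halfTurn.param y ∈ closedSquare (b.halfTurn hdisj).δ → ‖h‖ ≤ z₁ →
      T.halfTurn.emb (slabEquiv.symm (y, h)) ∈ V :=
    fun y h hy hh ↦ hVtube y h (pt2_one_one_sub_mem_closedSquare_iff.1 hy) hh
  obtain ⟨κR, cR, hκR, -, hinjR, hderR, havoidR, hlocR⟩ := WR.exists_good hz₁ hVtubeR
  -- the windows `φ 0 < φ 1 < ψ 0 < ψ 1 < φ 0 + 1` and the strips
  have h01 := hφ.zero_lt_one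
  have hψ01 := hψ.zero_lt_one
  have hηW := W.η_pos
  have hηR := WR.η_pos
  set g : ℝ := min (min W.η WR.η) (min (ψ 0 - φ 1) (φ 0 + 1 - ψ 1)) with hg
  have hg0 : 0 < g := lt_min (lt_min hηW hηR) (lt_min (by linarith) (by linarith))
  have hgW : g ≤ W.η := (min_le_left _ _).trans (min_le_left _ _)
  have hgR : g ≤ WR.η := (min_le_left _ _).trans (min_le_right _ _)
  have hg₁ : g ≤ ψ 0 - φ 1 := (min_le_right _ _).trans (min_le_left _ _)
  have hg₂ : g ≤ φ 0 + 1 - ψ 1 := (min_le_right _ _).trans (min_le_right _ _)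
  set ε₀ : ℝ := g / 4 with hε₀
  have hε₀0 : 0 < ε₀ := by rw [hε₀]; positivity
  set I₁ : Set ℝ := Ioo (φ 0 - ε₀) (φ 1 + ε₀) with hI₁
  set I₂ : Set ℝ := Ioo (ψ 0 - ε₀) (ψ 1 + ε₀) with hI₂
  set a : ℝ := φ 0 - 2 * ε₀ with ha
  have hIdisj : Disjoint I₁ I₂ := Set.disjoint_left.2 fun t ht ht' ↦ by
    have := ht.2; have := ht'.1; linarith
  have hI₁W : I₁ ⊆ Ioo (φ 0 - W.η) (φ 1 + W.η) := Ioo_subset_Ioo (by linarith) (by linarith)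
  have hI₂R : I₂ ⊆ Ioo (ψ 0 - WR.η) (ψ 1 + WR.η) := Ioo_subset_Ioo (by linarith) (by linarith)
  have hC₁ : Icc (φ 0) (φ 1) ⊆ I₁ := fun t ht ↦ ⟨by linarith [ht.1], by linarith [ht.2]⟩
  have hC₂ : Icc (ψ 0) (ψ 1) ⊆ I₂ := fun t ht ↦ ⟨by linarith [ht.1], by linarith [ht.2]⟩
  have hC₁I₂ : ∀ t ∈ Icc (φ 0) (φ 1), t ∉ I₂ := fun t ht h ↦ Set.disjoint_left.1 hIdisj (hC₁ ht) h
  have hC₂I₁ : ∀ t ∈ Icc (ψ 0) (ψ 1), t ∉ I₁ := fun t ht h ↦ Set.disjoint_left.1 hIdisj h (hC₂ ht)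
  -- the pieces agree with the curve of `K` off their windows
  have h₁ : ∀ u t, t ∈ I₁ → t ∉ Icc (φ 0) (φ 1) → W.fam κ c u t = Knot.curve K t := fun u t ht hn ↦
    W.fam_eq_curve_of_not_mem hκ c u (hI₁W ht) fun h ↦ hn (Ioo_subset_Icc_self h)
  have h₂ : ∀ u t, t ∈ I₂ → t ∉ Icc (ψ 0) (ψ 1) → WR.fam κR cR u t = Knot.curve K t := fun u t ht hn ↦
    WR.fam_eq_curve_of_not_mem hκR cR u (hI₂R ht) fun h ↦ hn (Ioo_subset_Icc_self h)
  -- the two-window family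
  set G : ℝ → ℝ → 𝔼 4 := twoWindowFam K (W.fam κ c) (WR.fam κR cR) I₁ I₂ with hGdef
  have hG₁ : ∀ u, ∀ t ∈ Icc (φ 0) (φ 1), G u t = W.fam κ c u t := fun u t ht ↦ twoWindowFam_of_mem_left u (hC₁ ht)
  have hG₂ : ∀ u, ∀ t ∈ Icc (ψ 0) (ψ 1), G u t = WR.fam κR cR u t := fun u t ht ↦
    twoWindowFam_of_mem_right hIdisj u (hC₂ ht)
  have hGcurve : ∀ u t, t ∉ Icc (φ 0) (φ 1) → t ∉ Icc (ψ 0) (ψ 1) → G u t = Knot.curve K t := fun u t h1 h2 ↦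
    twoWindowFam_eq_curve hIdisj h₁ h₂ u h1 h2
  have hGev₁ : ∀ u, ∀ t ∈ Icc (φ 0) (φ 1), G u =ᶠ[𝓝 t] W.fam κ c u := fun u t ht ↦ by
    filter_upwards [isOpen_Ioo.mem_nhds (hC₁ ht)] with s hs using twoWindowFam_of_mem_left u hs
  have hGev₂ : ∀ u, ∀ t ∈ Icc (ψ 0) (ψ 1), G u =ᶠ[𝓝 t] WR.fam κR cR u := fun u t ht ↦ by
    filter_upwards [isOpen_Ioo.mem_nhds (hC₂ ht)] with s hs using twoWindowFam_of_mem_right hIdisj u hs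
  -- parameters off the windows, in the fundamental domain, avoid the closed arcs
  have hoff₁ : ∀ t ∈ Ico a (a + 1), t ∉ Icc (φ 0) (φ 1) → K (circlePt t) ∉ b.lowerCurve '' Icc 0 1 := by
    intro t ht hn
    rw [mem_Icc, not_and_or, not_le, not_le] at hn
    rcases hn with hlt | hlt
    · exact K.apply_circlePt_not_mem_image_Icc_of_mem_Ioo_left hφ.continuous.continuousOn
        (hφ.strictMonoOn.mono Ioo_subset_Icc_self) hφ.2.2 ⟨by linarith [ht.1], hlt⟩
    · exact K.apply_circlePt_not_mem_image_Icc_of_mem_Ioo_right hφ.continuous.continuousOn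
        (hφ.strictMonoOn.mono Ioo_subset_Icc_self) hφ.2.2 ⟨hlt, by linarith [ht.2]⟩
  have hoff₂ : ∀ t ∈ Ico a (a + 1), t ∉ Icc (ψ 0) (ψ 1) →
      K (circlePt t) ∉ (b.halfTurn hdisj).lowerCurve '' Icc 0 1 := by
    intro t ht hn
    rw [mem_Icc, not_and_or, not_le, not_le] at hn
    rcases hn with hlt | hlt
    · exact K.apply_circlePt_not_mem_image_Icc_of_mem_Ioo_left hψ.continuous.continuousOn
        (hψ.strictMonoOn.mono Ioo_subset_Icc_self) hψ.2.2 ⟨by linarith [ht.1], hlt⟩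
    · exact K.apply_circlePt_not_mem_image_Icc_of_mem_Ioo_right hψ.continuous.continuousOn
        (hψ.strictMonoOn.mono Ioo_subset_Icc_self) hψ.2.2 ⟨hlt, by linarith [ht.2]⟩
  -- the smooth family of modifications
  have hmod : K.IsModification a ε₀ G (Icc (φ 0) (φ 1) ∪ Icc (ψ 0) (ψ 1)) :=
    { ε_pos := hε₀0
      contDiff := contDiff_twoWindowFam isOpen_Ioo isOpen_Ioo hIdisj isClosed_Icc isClosed_Icc hC₁ hC₂
        (fun p hp ↦ W.contDiffAt_fam κ c (hI₁W hp)) (fun p hp ↦ WR.contDiffAt_fam κR cR (hI₂R hp)) h₁ h₂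
      subset := by
        rintro t (ht | ht)
        · exact ⟨by linarith [ht.1], by linarith [ht.2]⟩
        · exact ⟨by linarith [ht.1], by linarith [ht.2]⟩
      isClosed := isClosed_Icc.union isClosed_Icc
      eq_curve := fun u t ht ↦ by
        rw [mem_union, not_or] at ht
        exact hGcurve u t ht.1 ht.2
      zero_eq := fun t ↦ by
        by_cases ht₁ : t ∈ I₁
        · rw [hGdef, twoWindowFam_of_mem_left 0 ht₁, W.fam_zero κ c (hI₁W ht₁)]
        by_cases ht₂ : t ∈ I₂
        · rw [hGdef, twoWindowFam_of_mem_right hIdisj 0 ht₂, WR.fam_zero κR cR (hI₂R ht₂)]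
        · rw [hGdef, twoWindowFam_of_not_mem 0 ht₁ ht₂]
      norm_eq_one := by
        rintro u - t (ht | ht)
        · rw [hG₁ u t ht]; exact W.norm_fam κ c u t
        · rw [hG₂ u t ht]; exact WR.norm_fam κR cR u t
      deriv_ne_zero := by
        rintro u - t (ht | ht)
        · rw [(hGev₁ u t ht).deriv_eq]; exact hder u t ht
        · rw [(hGev₂ u t ht).deriv_eq]; exact hderR u t ht
      injOn := by
        rintro u - s (hs | hs) t (ht | ht) hst
        · rw [hG₁ u s hs, hG₁ u t ht] at hst; exact hinj u hs ht hst
        · exfalso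
          rw [hG₁ u s hs, hG₂ u t ht] at hst
          obtain ⟨y, h, hy, hy1, -⟩ := hloc u s hs
          obtain ⟨y', h', hy', hy1', -⟩ := hlocR u t ht
          rw [hy, hy'] at hst
          have heq : (y, h) = (y', h') := T.injective_slabMap hst
          rw [Prod.mk.injEq] at heq
          have : T.halfTurn.param y' 1 = 1 - T.param y' 1 := by
            show (pt2 1 1 - T.param y') 1 = _; rw [pt2_one_one_sub_apply]
          rw [this, ← heq.1] at hy1'
          linarith
        · exfalso
          rw [hG₂ u s hs, hG₁ u t ht] at hst
          obtain ⟨y, h, hy, hy1, -⟩ := hlocR u s hs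
          obtain ⟨y', h', hy', hy1', -⟩ := hloc u t ht
          rw [hy, hy'] at hst
          have heq : (y, h) = (y', h') := T.injective_slabMap hst
          rw [Prod.mk.injEq] at heq
          have : T.halfTurn.param y 1 = 1 - T.param y 1 := by
            show (pt2 1 1 - T.param y) 1 = _; rw [pt2_one_one_sub_apply]
          rw [this, heq.1] at hy1
          linarith
        · rw [hG₂ u s hs, hG₂ u t ht] at hst; exact hinjR u hs ht hst
      disjoint := by
        rintro u - s (hs | hs) t ht hnot heq
        · rw [mem_union, not_or] at hnot
          rw [hG₁ u s hs] at heq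
          exact havoid u s hs t (hoff₁ t ht hnot.1) heq
        · rw [mem_union, not_or] at hnot
          rw [hG₂ u s hs] at heq
          exact havoidR u s hs t (hoff₂ t ht hnot.2) heq }
  -- the moving points stay in `V`
  have hGO : ∀ y : 𝕊 3, y ∉ V → ∀ u ∈ Icc (0 : ℝ) 1, ∀ s ∈ Icc (φ 0) (φ 1) ∪ Icc (ψ 0) (ψ 1), (y : 𝔼 4) ≠ G u s := by
    rintro y hy u - s (hs | hs) heq
    · obtain ⟨y₀, h, hy₀, -, hV₀⟩ := hloc u s hs
      rw [hG₁ u s hs, hy₀, PatchThickening.slabMap_apply] at heq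
      exact hy (Subtype.ext heq ▸ hV₀)
    · obtain ⟨y₀, h, hy₀, -, hV₀⟩ := hlocR u s hs
      rw [hG₂ u s hs, hy₀, PatchThickening.slabMap_apply] at heq
      exact hy (Subtype.ext heq ▸ hV₀)
  obtain ⟨Ψ, hΨV, -, hΨ1⟩ := hmod.exists_ambientIsotopy hV hGO
  -- values of the end stage on `K`
  have hval : ∀ t ∈ Ico a (a + 1), ((Ψ.toFun 1 (K (circlePt t)) : 𝕊 3) : 𝔼 4) = G 1 t := fun t ht ↦ by
    rw [hΨ1 t, periodise_eq_self a _ ht]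
  have hval₁ : ∀ t ∈ Icc (φ 0) (φ 1), Ψ.toFun 1 (K (circlePt t)) = K' (circlePt (W.σ t)) := by
    intro t ht
    apply Subtype.ext
    rw [hval t ⟨by linarith [ht.1], by linarith [ht.2]⟩, hG₁ 1 t ht, W.fam_one κ c (hI₁W (hC₁ ht)), Knot.curve_apply]
  have hval₂ : ∀ t ∈ Icc (ψ 0) (ψ 1), Ψ.toFun 1 (K (circlePt t)) = K' (circlePt (WR.σ t)) := by
    intro t ht
    apply Subtype.ext
    rw [hval t ⟨by linarith [ht.1], by linarith [ht.2]⟩, hG₂ 1 t ht, WR.fam_one κR cR (hI₂R (hC₂ ht)), Knot.curve_apply]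
  -- points of `K` off the band surface are fixed by the end stage
  have hfix : ∀ t ∈ Ico a (a + 1), K (circlePt t) ∉ b.support → Ψ.toFun 1 (K (circlePt t)) = K (circlePt t) := by
    intro t ht hns
    have hn₁ : t ∉ Ioo (φ 0) (φ 1) := fun h ↦ hns (by
      obtain ⟨s, hs, hse⟩ := b.apply_circlePt_mem_lowerCurve_image hφ.continuous hφ.strictMonoOn hφ.2.2 h
      rw [← hse]; exact b.lowerCurve_mem_support hs)
    have hn₂ : t ∉ Ioo (ψ 0) (ψ 1) := fun h ↦ hns (by
      obtain ⟨s, hs, hse⟩ := (b.halfTurn hdisj).apply_circlePt_mem_lowerCurve_image hψ.continuous hψ.strictMonoOn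
        hψ.2.2 h
      rw [← hse, ← b.halfTurn_support hdisj]; exact (b.halfTurn hdisj).lowerCurve_mem_support hs)
    apply Subtype.ext
    rw [hval t ht, ← Knot.curve_apply]
    by_cases ht₁ : t ∈ I₁
    · rw [hGdef, twoWindowFam_of_mem_left 1 ht₁]; exact W.fam_eq_curve_of_not_mem hκ c 1 (hI₁W ht₁) hn₁
    by_cases ht₂ : t ∈ I₂
    · rw [hGdef, twoWindowFam_of_mem_right hIdisj 1 ht₂]; exact WR.fam_eq_curve_of_not_mem hκR cR 1 (hI₂R ht₂) hn₂
    · rw [hGdef, twoWindowFam_of_not_mem 1 ht₁ ht₂]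
  refine ⟨Ψ, fun t x hx ↦ hΨV t x hx, ?_, ?_⟩
  · -- the image of `K`
    apply Subset.antisymm
    · rintro _ ⟨x, hx, rfl⟩
      obtain ⟨t, ht, rfl⟩ := K.exists_mem_Ico_apply_circlePt_eq a hx
      by_cases hts : K (circlePt t) ∈ b.support
      · -- on an open arc: carried onto the corresponding arc of `K'`
        rcases b.mem_arcs_of_mem_support (mem_range_self _) hts with hl | hu
        · have htw := b.mem_Ioo_of_apply_mem_lowerCurve_image hφ (by linarith) (by linarith) ht hl
          rw [hval₁ t (Ioo_subset_Icc_self htw)]; exact mem_range_self _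
        · have hu' : K (circlePt t) ∈ (b.halfTurn hdisj).lowerCurve '' Ioo 0 1 := by
            simpa only [halfTurn_lowerCurve] using hu
          have htw := (b.halfTurn hdisj).mem_Ioo_of_apply_mem_lowerCurve_image hψ (by linarith) (by linarith) ht hu'
          rw [hval₂ t (Ioo_subset_Icc_self htw)]; exact mem_range_self _
      · -- off the band surface: fixed, and a point of `K'`
        rw [hfix t ht hts]
        have hmem : K (circlePt t) ∈ range K \ b.support := ⟨mem_range_self _, hts⟩
        rw [← b.range_diff_support_eq b' hband.symm hδ.symm] at hmem
        exact hmem.1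
    · intro x' hx'
      rw [b'.range_eq_diff_union_arcs] at hx'
      rcases hx' with hx' | (⟨s', hs', rfl⟩ | ⟨s', hs', rfl⟩)
      · -- off the band surface: a fixed point of `K`
        rw [b.range_diff_support_eq b' hband.symm hδ.symm] at hx'
        obtain ⟨t, ht, hte⟩ := K.exists_mem_Ico_apply_circlePt_eq a hx'.1
        refine ⟨K (circlePt t), mem_range_self _, ?_⟩
        rw [hfix t ht (hte ▸ hx'.2), hte]
      · -- on the open lower arc of `K'`
        have hmem : φ' s' ∈ Icc (φ' 0) (φ' 1) :=
          ⟨hφ'.strictMonoOn.monotoneOn (left_mem_Icc.2 zero_le_one) (Ioo_subset_Icc_self hs') hs'.1.le,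
            hφ'.strictMonoOn.monotoneOn (Ioo_subset_Icc_self hs') (right_mem_Icc.2 zero_le_one) hs'.2.le⟩
        obtain ⟨t, ht, hte⟩ := W.surjOn hmem
        refine ⟨K (circlePt t), mem_range_self _, ?_⟩
        rw [hval₁ t ht, hte, hφ'.apply_eq (Ioo_subset_Icc_self hs')]
      · -- on the open upper arc of `K'`
        have hmem : ψ' s' ∈ Icc (ψ' 0) (ψ' 1) :=
          ⟨hψ'.strictMonoOn.monotoneOn (left_mem_Icc.2 zero_le_one) (Ioo_subset_Icc_self hs') hs'.1.le,
            hψ'.strictMonoOn.monotoneOn (Ioo_subset_Icc_self hs') (right_mem_Icc.2 zero_le_one) hs'.2.le⟩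
        obtain ⟨t, ht, hte⟩ := WR.surjOn hmem
        refine ⟨K (circlePt t), mem_range_self _, ?_⟩
        rw [hval₂ t ht, hte, hψ'.apply_eq (Ioo_subset_Icc_self hs'), halfTurn_lowerCurve]
  · -- the orientation clause
    refine b.sameOrientationAt_of_fix b' hband.symm hδ.symm hcl hdisj (Ψ.contMDiff_toFun 1) ?_ ?_
    · have h0 : φ 0 ∈ Ico a (a + 1) := ⟨by linarith, by linarith⟩
      rw [← hφ.apply_zero]
      exact hfix (φ 0) h0 (hφ.apply_zero ▸ b.band_corner_not_mem_support hcl (Or.inl rfl) (Or.inl rfl))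
    · intro x hx hxs
      obtain ⟨t, ht, rfl⟩ := K.exists_mem_Ico_apply_circlePt_eq a hx
      exact hfix t ht hxs

/-! ### The named facts of `BandSumIsotopyRegular.lean` -/

/-- **Discharge of the corrected geometric heart**
`Literature.Topology.FourManifolds.BandData.exists_ambientIsotopy_of_band_eq_of_isRegular`: two band
sums of `K₁`, `K₂` along the same *regular* band with the same collar width have ambient isotopic
oriented images, by an ambient isotopy stationary off any neighbourhood of the closure of the band
surface (`exists_ambientIsotopy_of_isRegular_lift`, with the disjointness of the summands
`Knot.IsBandSum.disjoint_range_holds`). Gompf–Stipsicz (1999), §5.1 (the band sum along a given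
band is well defined); Cromwell (2004), §4.6; Hirsch (1976), Ch. 8 §1, Thm. 1.3 (isotopy
extension). [cite: GompfStipsicz1999, §5.1] -/
theorem exists_ambientIsotopy_of_band_eq_of_isRegular_holds : exists_ambientIsotopy_of_band_eq_of_isRegular :=
  fun b b' hreg hband hδ V hV hVsub ↦
    b.exists_ambientIsotopy_of_isRegular_lift b' hreg (Knot.IsBandSum.disjoint_range_holds ⟨b⟩) hband hδ V hV hVsub

/-- **Discharge of the printed theorem**
`Literature.Topology.FourManifolds.BandData.isIsotopic_of_band_eq_of_isRegular`: a band sum along a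
regular band depends only on the band (through the landed reduction
`isIsotopic_of_band_eq_of_isRegular_of`). Gompf–Stipsicz (1999), §5.1; Cromwell (2004), §4.6;
Kirby (1989), Ch. I §2, p. 10. [cite: GompfStipsicz1999, §5.1] -/
theorem isIsotopic_of_band_eq_of_isRegular_holds : isIsotopic_of_band_eq_of_isRegular :=
  isIsotopic_of_band_eq_of_isRegular_of exists_ambientIsotopy_of_band_eq_of_isRegular_holds

end BandData

end LiftAssembly


end Literature.Topology.FourManifolds
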